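import Summits.QuantumFields.YangMills.Theorems.IR.Negative.TypShellCondFalseFixedMesh

/-!
# Crux `IR` (stmt-QuantumFields-19354) — THE FRAME-TWIST ROW WITH BOTH NAMED INPUTS DISCHARGED:
# the fixed-mesh negative for format T and the onset floor FOR EVERY COMPACT GAUGE GROUP (sorry-free)

Crux-ideate seat `ym-cruxidea-19354-2` GEN 6 (planner, lens negation; count-neutral).  Crux workfile = scratch that
elaborates; nothing here is imported by a Theorems module.  Namespace `Summit.QuantumFields.YangMills.Cruxes.IR.CruxIdea2g6`.

WHAT IS PROVED (no `sorry`; axioms `propext`, `Classical.choice`, `Quot.sound` — `#print axioms typOnsetFloor_allG`),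
against the tree mirror `OnsetFormats.TypShellCond` of the registered format T (slot «af-pincer-Uc»: format Uc implies
it, `AfPincerUc.typShellCond_of_UKPc`):

* `not_typShellCond_fixedMesh_allG` — for EVERY compact (second countable) `G`, every continuous faithful unitary
  `ρ : G →* M_N(ℂ)`, `N ≥ 1`, EVERY `k₀ : G`, mesh `b ≥ 1`, window `n`, budgets `2ε < 1 − Re χ_ρ(k₀)/N`, `0 ≤ δ`,
  `4·#windowCellsPlus(n)·δ < 1`:  `∃ β₀ ∀ β ≥ β₀, ¬ TypShellCond ρ β b n ε δ`.  NO centre, NO scalar hypothesis — the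
  tree's `not_typShellCond_fixedMesh` (`Theorems/IR/Negative/TypShellCondFalseFixedMesh.lean`) needs a central `g₀` with
  `ρ g₀ = c • 1`, `c ≠ 1`; here `G` may be centre-free (`SO(3)`, `G₂`, `F₄`, `E₈`, `PSU(N)`) and `ρ` any faithful
  representation; `re_trace_div_lt_one`: the budget is satisfiable with `ε > 0` as soon as `k₀ ≠ 1`.
* `typOnsetFloor_allG` — the same uniformly on every bounded mesh range `1 ≤ b ≤ B`: the typical onset `b⋆_T(β)` (a
  fortiori `b⋆_Uc(β)`) exceeds every bound eventually, for every non-trivial compact gauge group (the route owner's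
  R74 (b) «onset-divergence-for-all-`G` datum»; R74 (c): the guard `HasScalarCentre` of certideate-2's row-onset split
  is NOT needed for divergence — only for the quantitative rate).
* rev 2 — THE CLIPPED TEST: `not_typShellCond_fixedMesh_allG'` ∕ `typOnsetFloor_allG'` — the same at EVERY budget
  `ε < 1` for every `k₀ ≠ 1` (shape the charged test by `ψ t = max (-1) (min 1 (2(t−r)/(1−r) − 1))`, `r = Re χ_ρ(k₀)/N`:
  frozen value `ψ 1 = 1`, twisted value `ψ r = −1`, separation `2`); `not_typShellCond_fixedMesh_of_nontrivial`
  (`[Nontrivial G]`, nothing to choose).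
* rev 2 — ROW STRENGTH and certideate-2's NAMED PROPS: `frame_core` derives the contradiction from PRIMITIVE data (a
  measurable cell-local class `Typ`, clause (i) asked ONLY at `Y = rowCells n` — `RowClauseI`, certideate-2's text
  verbatim — and the single-cell torus anchor on window+shell), so the weaker ROW formats fail too:
  `not_rowShellCond_fixedMesh_allG`, `not_rowShellCondUKP_fixedMesh_allG` (`k₀ ≠ 1`, `ε < 1`), and the Props
  `RowOnsetDivergesAny ρ`, `RowOnsetDivergesAll ρ`, `RowOnsetDivergesAnyU ρ` of `ym-19354-certideate-2/Sketch-g14.lean` §C∕§G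
  (texts copied verbatim, §11⁰) HOLD FOR EVERY `ρ`: `rowOnsetDivergesAny_allG`, `rowOnsetDivergesAll_allG`,
  `rowOnsetDivergesAnyU_allG` — the guard `HasScalarCentre` of the row-onset split is not a divergence guard (kernel fact).
* The two NAMED INPUTS of GEN 5's composition `not_typShellCond_frame` (tree `Cruxes/IR/CruxIdea2FrameRow.lean`
  7720daf266c53c8b, §1–§5 copied here verbatim into this namespace) are THEOREMS for the concrete field-dependent twist
  `κ = comb b ((2n+2)b+1) k₀` (the LAYER COMB: `k₀` transported from a root along a staircase inside the height-`(b+1)`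
  site layer): INPUT T `topTwistTransfer_comb` and INPUT F `frameValueBound_comb` (value `r = Re χ_ρ(k₀)/N`).

CHAIN (sections keep the seat's working numbers):
* §6 `laplace_upper_uniform` — an abstract UNIFORM soft Laplace upper bound: `X` compact with a finite open-positive
  measure, compact first-countable parameter space `Y`, continuous `S, g : Y × X → ℝ`, closed `K ⊆ Y`; if `g ≤ r` at
  every minimiser of `S(y,·)` for `y ∈ K`, then `∫ g e^{-βS} ≤ (r+s) ∫ e^{-βS}` for `β ≥ β₀` uniformly on an open
  `O ⊇ K` (compactness + closed projection; no rate, no Hessian).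
* g5 §1∕§3 (verbatim): the rim-top twist `topTwist b k ζ` (right-multiplies the vertical links from height `b` to `b+1`
  by `k(top)⁻¹`) IS the gauge transformation `layerGauge b k` on every row-layer cell and the identity off the row
  layer; the twisted staple `staple (topTwist b k ζ) = (A k_m A⁻¹) · staple ζ`.
* §7 the layer comb `comb b R k₀ ζ x = stair(x)⁻¹ k₀ stair(x)` (`zline`, `stair` along directions 1, 2, 3 from the root
  `(b+1,-R,-R,-R)`): covariantly constant along the comb links BY CONSTRUCTION (`stair_add_single_three`, `…_two_base`,
  `…_one_base`) and along every layer link for FLAT `ζ` (`layerCov_comb`, discrete Stokes); for flat `ζ` the twisted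
  datum is flat above the comb's base (`flat_topTwist`).
* §8 zero temperature: LOCAL planar Stokes (`col_mul_staple_eq_one_local`), zero Wilson action ⇒ flat torus
  (`torusFlat_of_wilsonAction_eq_zero`, faithfulness), zero boundary action of the twisted flat datum
  (`wilsonBoundaryAction_topTwist_eq_zero`) ⇒ every minimiser of the twisted row-region boundary action is flat on the
  touching plaquettes ⇒ the cell-`0` charged test read against the UNtwisted staple equals `Re χ_ρ(k₀)/N` EXACTLY at
  every minimiser (`chargedTest_re_eq_of_minimiser_comb`: `staple_topTwist` + covariance + `trace_rep_conj`).
* §9 INPUT F `frameValueBound_comb`: §6 with `Y` = the torus configurations (compact), `K` = the zero set of the Wilson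
  action, `S` = the twisted boundary action of the glued configuration, `g` = the charged test; the complement of `O`
  has positive minimal action, so torus plaquette FREEZING (`Freezing.tendsto_integral_wilsonMeasure`) + Markov make it
  `μ_β`-negligible; inside `O` the row kernel's twisted mean is `≤ r + η`.
* §10a `measurePreserving_gaugeTransform_dep` ∕ `wilsonMeasure_map_gaugeTransform_dep` — a CONFIGURATION-DEPENDENT gauge
  transformation `V ↦ V^{h(V)}` preserves product Haar (and the Wilson measure) whenever `h(V)` reads only links of a set
  `p` that the transformation fixes: skew product over the identity on `V|_p` with two-sided Haar translations in the
  fibres (`MeasurePreserving.skew_product`, `measurePreserving_piEquivPiSubtypeProd`); general in `d`, `L`, `p`, `h`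
  (ctriage-2 S-FTR-1: reusable by every `FixedMesh/` twisted pair).
* §10b INPUT T `topTwistTransfer_comb`: the comb's gauge tree on the torus of side `2R+1` read through centred
  representatives (`IsTreeEdge`, `treeGauge`, `treeGauge_dep`, `treeGauge_fix`), the row-layer∕off-layer case split of
  g5 §1, `cellEdges_endpoints_mem_box` + `Torus.cRep_proj_of_mem_box`; transport with EQUALITY.
* §11⁰ the row formats (certideate-2's defs verbatim); §11a (g5 §2 at row strength) clause (i) at the row ⇒
  two-kernel bound for the admissible pair `(ζ, topTwist b k ζ)` and any cell-`0` cylinder `|u| ≤ 1`; §11b `frame_core`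
  (rev 2: SHAPED test `ψ ∘ Re`, `|ψ| ≤ 1` on `[−1,1]`, domination `1 − ψ t ≤ A(1 − t)` transfers torus loop FREEZING to
  the shaped loop; properness `integral_comp_loopObs_eq`; INPUT F for `(κ, ψ)` = `FrameValueBoundObs`, for the comb
  and every continuous `ψ` = `frameValueBoundObs_comb`, value `ψ(r)`); `not_typShellCond_frame` = the case `ψ = id`;
  §11c the headlines (`frame_core_comb_clipped`: `ψ` = the clipped affine map, `A = 2/(1−r)`).

WHAT THIS IS NOT.  It refutes NO registered stub: `OnsetMixingTypicalUKPc` ∕ the tree's `OnsetMixingTypical` put `∃ b`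
AFTER `∀ β ≥ β₂` (`b = b(β)` may grow), and the freezing input lives on ONE torus of side `2((2n+2)b+1)+1` at fixed `b`
— it binds for `b ≪ ξ_G(β)` only (numbers: tree `TypShellCondFalseFixedMesh` READING).  No estimate is proved here: every
step is soft (compactness, exact gauge covariance, exact lattice Stokes, dominated convergence in the tree's freezing).
Budgets: the character test gives `2ε < 1 − Re χ_ρ(k₀)/N` (rev 1 headline); the clipped test gives EVERY `ε < 1` (rev 2).
Axiom audit (`#print axioms`, rev 2): `rowOnsetDivergesAny_allG`, `rowOnsetDivergesAnyU_allG`,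
`not_typShellCond_fixedMesh_allG'`, `typOnsetFloor_allG` depend on `[propext, Classical.choice, Quot.sound]` only.
-/

set_option autoImplicit false

noncomputable section

open MeasureTheory Filter Topology
open Literature.MathematicalPhysics.QuantumLattice
open Literature.Probability.LatticeModels
open Summit.QuantumFields.YangMills.Cruxes.IR.Tempered (cellEdges windowCells regionEdges)
open Summit.QuantumFields.YangMills.Cruxes.IR.ShellTempered (windowCellsPlus)
open Summit.QuantumFields.YangMills.Cruxes.IR.OnsetFormats (TypShellCond shellCount)
open Summit.QuantumFields.YangMills.Cruxes.IR.FixedMesh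

namespace Summit.QuantumFields.YangMills.Cruxes.IR.CruxIdea2g6

section UniformLaplace

variable {X Y : Type*} [TopologicalSpace X] [CompactSpace X] [MeasurableSpace X] [OpensMeasurableSpace X]
  [TopologicalSpace Y] [CompactSpace Y] [FirstCountableTopology Y]

/-- **Uniform Laplace upper bound (abstract; PROVED).**  `X` compact with a finite open-positive reference
measure `μ`, `Y` a compact (first countable) parameter space, `S, g : Y × X → ℝ` continuous, `K ⊆ Y` closed.
If at every parameter `y ∈ K` the observable `g (y, ·)` is `≤ r` at every MINIMISER of `S (y, ·)`, then for every
`s > 0` there are an open `O ⊇ K` and `β₀` such that the Gibbs averages satisfy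
`∫ g e^{-β S} dμ ≤ (r + s) ∫ e^{-β S} dμ` for all `β ≥ β₀` and all `y ∈ O` (uniformly on a neighbourhood of `K`).
Proof: continuity of `m(y) = inf S(y,·)` (compactness), the defect `D = S - m ≥ 0`; on `K` the sub-level set
`{g ≥ r + s/2}` is compact and misses `{D = 0}`, so `D ≥ 2ε₁` there; the closed set `{D ≤ ε₁ ∧ g ≥ r + s/2}` has
closed projection (compact fibre) missing `K` — its complement is `O`; a uniform lower bound
`∫ e^{-βD} ≥ c e^{-βε₁/2}` comes from the continuous positive function `y ↦ ∫ ψ(D(y,x)) dμ` (`ψ` a cutoff at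
`ε₁/2`, Haar-type open positivity); the tail `{D > ε₁}` is then `O(e^{-βε₁/2})` relative to the mass. -/
theorem laplace_upper_uniform (μ : Measure X) [IsFiniteMeasure μ] [μ.IsOpenPosMeasure]
    {S g : Y × X → ℝ} (hS : Continuous S) (hg : Continuous g) {K : Set Y} (hK : IsClosed K) {r : ℝ}
    (hmin : ∀ y ∈ K, ∀ x, (∀ x', S (y, x) ≤ S (y, x')) → g (y, x) ≤ r) {s : ℝ} (hs : 0 < s) :
    ∃ O : Set Y, IsOpen O ∧ K ⊆ O ∧ ∃ β₀ : ℝ, ∀ β : ℝ, β₀ ≤ β → ∀ y ∈ O,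
      ∫ x, g (y, x) * Real.exp (-β * S (y, x)) ∂μ ≤ (r + s) * ∫ x, Real.exp (-β * S (y, x)) ∂μ := by
  classical
  rcases isEmpty_or_nonempty X with hX | hX
  · -- no points: all integrals vanish
    refine ⟨Set.univ, isOpen_univ, Set.subset_univ _, 0, fun β _ y _ => ?_⟩
    have h0 : μ = 0 := Measure.eq_zero_of_isEmpty μ
    simp [h0]
  -- the minimal energy `m` and the defect `D`
  set m : Y → ℝ := fun y => sInf ((fun x => S (y, x)) '' Set.univ) with hm
  have hmc : Continuous m :=
    isCompact_univ.continuous_sInf (f := fun (y : Y) (x : X) => S (y, x))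
      (show Continuous (↿fun (y : Y) (x : X) => S (y, x)) from hS.comp (continuous_fst.prodMk continuous_snd))
  have hbdd : ∀ y, BddBelow ((fun x => S (y, x)) '' Set.univ) := fun y =>
    (isCompact_univ.image (hS.comp (Continuous.prodMk_right y))).bddBelow
  have hm_le : ∀ y x, m y ≤ S (y, x) := fun y x => csInf_le (hbdd y) ⟨x, Set.mem_univ x, rfl⟩
  have hm_att : ∀ y, ∃ x, S (y, x) = m y := fun y => by
    obtain ⟨x, -, hx⟩ := isCompact_univ.exists_sInf_image_eq Set.univ_nonempty
      (hS.comp (Continuous.prodMk_right y)).continuousOn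
    exact ⟨x, hx.symm⟩
  set D : Y × X → ℝ := fun p => S p - m p.1 with hD
  have hDc : Continuous D := hS.sub (hmc.comp continuous_fst)
  have hD0 : ∀ p, 0 ≤ D p := fun p => by
    have := hm_le p.1 p.2
    simp only [hD]; linarith
  have hDmin : ∀ y x, D (y, x) = 0 → ∀ x', S (y, x) ≤ S (y, x') := fun y x h x' => by
    have h1 : S (y, x) = m y := by simp only [hD] at h; linarith
    rw [h1]; exact hm_le y x'
  -- Step 1: on `K`, `g ≥ r + s/2` forces a defect `≥ 2ε₁`
  obtain ⟨ε₁, hε₁, hsep⟩ : ∃ ε₁ : ℝ, 0 < ε₁ ∧ ∀ p : Y × X, p.1 ∈ K → r + s / 2 ≤ g p → 2 * ε₁ ≤ D p := by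
    set C : Set (Y × X) := {p | p.1 ∈ K ∧ r + s / 2 ≤ g p} with hC
    have hCc : IsCompact C :=
      ((hK.preimage continuous_fst).inter (isClosed_le continuous_const hg)).isCompact
    by_cases hne : C.Nonempty
    · obtain ⟨p₀, hp₀, hle⟩ := hCc.exists_isMinOn hne hDc.continuousOn
      have hpos : 0 < D p₀ := by
        rcases (hD0 p₀).lt_or_eq with h | h
        · exact h
        · exfalso
          have hg0 : g (p₀.1, p₀.2) ≤ r := hmin p₀.1 hp₀.1 p₀.2 (hDmin p₀.1 p₀.2 h.symm)
          have : r + s / 2 ≤ g p₀ := hp₀.2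
          simp only [Prod.mk.eta] at hg0
          linarith
      refine ⟨D p₀ / 2, by positivity, fun p hpK hpg => ?_⟩
      have := hle (show p ∈ C from ⟨hpK, hpg⟩)
      rw [Set.mem_setOf_eq] at this
      linarith
    · exact ⟨1, one_pos, fun p hpK hpg => (hne ⟨p, hpK, hpg⟩).elim⟩
  -- Step 2: the open neighbourhood `O` of `K`
  set Bad : Set (Y × X) := {p | D p ≤ ε₁ ∧ r + s / 2 ≤ g p} with hBad
  have hBadc : IsClosed Bad := (isClosed_le hDc continuous_const).inter (isClosed_le continuous_const hg)
  set O : Set Y := (Prod.fst '' Bad)ᶜ with hO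
  have hOo : IsOpen O := (isClosedMap_fst_of_compactSpace _ hBadc).isOpen_compl
  have hKO : K ⊆ O := by
    rintro y hy ⟨p, hp, rfl⟩
    have h2 := hsep p hy hp.2
    have h1 := hp.1
    linarith
  have hgood : ∀ y ∈ O, ∀ x, D (y, x) ≤ ε₁ → g (y, x) < r + s / 2 := fun y hy x hDx => by
    by_contra h
    exact hy ⟨(y, x), ⟨hDx, not_lt.1 h⟩, rfl⟩
  -- Step 3: a uniform lower bound for the defect partition function
  set ψ : ℝ → ℝ := fun t => max 0 (1 - 2 * t / ε₁) with hψ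
  have hψc : Continuous ψ := continuous_const.max (continuous_const.sub (continuous_const.mul continuous_id
    |>.div_const _))
  have hψ0 : ∀ t, 0 ≤ ψ t := fun t => le_max_left _ _
  have hψ1 : ∀ t, 0 ≤ t → ψ t ≤ 1 := fun t ht => max_le zero_le_one (by
    have : 0 ≤ 2 * t / ε₁ := by positivity
    linarith)
  have hψvan : ∀ t, ε₁ / 2 ≤ t → ψ t = 0 := fun t ht => by
    refine max_eq_left ?_
    rw [sub_nonpos, le_div_iff₀ hε₁]; linarith
  set Φ : Y → ℝ := fun y => ∫ x, ψ (D (y, x)) ∂μ with hΦ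
  have hΦc : Continuous Φ :=
    continuous_integral_of_bound (fun y => hψc.comp (hDc.comp (Continuous.prodMk_right y)))
      (fun x => hψc.comp (hDc.comp (Continuous.prodMk_left x))) (C := 1) fun y x => by
        rw [abs_of_nonneg (hψ0 _)]; exact hψ1 _ (hD0 _)
  have hΦpos : ∀ y, 0 < Φ y := fun y => by
    obtain ⟨x₀, hx₀⟩ := hm_att y
    have hD00 : D (y, x₀) = 0 := by simp only [hD, hx₀, sub_self]
    refine (hψc.comp (hDc.comp (Continuous.prodMk_right y))).integral_pos_of_hasCompactSupport_nonneg_nonzero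
      (HasCompactSupport.of_compactSpace _) (fun x => hψ0 _) (x := x₀) ?_
    simp only [hD00, hψ, mul_zero, zero_div, sub_zero]
    norm_num
  obtain ⟨c, hc, hcΦ⟩ : ∃ c : ℝ, 0 < c ∧ ∀ y, c ≤ Φ y := by
    rcases isEmpty_or_nonempty Y with hY | hY
    · exact ⟨1, one_pos, fun y => (IsEmpty.false y).elim⟩
    · obtain ⟨y₀, -, hy₀⟩ := isCompact_univ.exists_isMinOn Set.univ_nonempty hΦc.continuousOn
      exact ⟨Φ y₀, hΦpos y₀, fun y => hy₀ (Set.mem_univ y)⟩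
  have hint : ∀ {f : Y × X → ℝ}, Continuous f → ∀ y, Integrable (fun x => f (y, x)) μ := fun hf y =>
    Summit.QuantumFields.YangMills.Theorems.TunedSequenceExists.Negative.Freezing.integrable_of_continuous μ
      (hf.comp (Continuous.prodMk_right y))
  have hZ_ge : ∀ y, ∀ β : ℝ, 0 ≤ β →
      c * Real.exp (-β * (ε₁ / 2)) ≤ ∫ x, Real.exp (-β * D (y, x)) ∂μ := fun y β hβ => by
    have hpt : ∀ x, ψ (D (y, x)) * Real.exp (-β * (ε₁ / 2)) ≤ Real.exp (-β * D (y, x)) := fun x => by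
      by_cases hx : ε₁ / 2 ≤ D (y, x)
      · rw [hψvan _ hx, zero_mul]; exact (Real.exp_pos _).le
      · calc ψ (D (y, x)) * Real.exp (-β * (ε₁ / 2)) ≤ 1 * Real.exp (-β * (ε₁ / 2)) :=
              mul_le_mul_of_nonneg_right (hψ1 _ (hD0 _)) (Real.exp_pos _).le
          _ ≤ Real.exp (-β * D (y, x)) := by
              rw [one_mul]; exact Real.exp_le_exp.2 (by nlinarith [not_le.1 hx])
    calc c * Real.exp (-β * (ε₁ / 2)) ≤ Φ y * Real.exp (-β * (ε₁ / 2)) :=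
          mul_le_mul_of_nonneg_right (hcΦ y) (Real.exp_pos _).le
      _ = ∫ x, ψ (D (y, x)) * Real.exp (-β * (ε₁ / 2)) ∂μ := (integral_mul_const _ _).symm
      _ ≤ ∫ x, Real.exp (-β * D (y, x)) ∂μ :=
          integral_mono ((hint (hψc.comp hDc) y).mul_const _)
            (hint (Real.continuous_exp.comp (continuous_const.mul hDc)) y) hpt
  -- Step 4: the tail rate and `β₀`
  obtain ⟨M, hM⟩ := exists_bound_of_continuous hg
  set C₁ : ℝ := |M| + |r + s / 2| with hC₁
  have hC₁0 : 0 ≤ C₁ := by positivity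
  have hgC : ∀ p, |g p - (r + s / 2)| ≤ C₁ := fun p =>
    (abs_sub _ _).trans (add_le_add ((hM p).trans (le_abs_self M)) le_rfl)
  set U : ℝ := μ.real Set.univ with hU
  have hU0 : 0 ≤ U := measureReal_nonneg
  set q : ℝ := s * c / (2 * (C₁ * U + 1)) with hq
  have hq0 : 0 < q := by positivity
  have hqkey : C₁ * U * q ≤ s / 2 * c := by
    rw [hq]
    have h1 : 0 < C₁ * U + 1 := by positivity
    rw [show C₁ * U * (s * c / (2 * (C₁ * U + 1))) = (s / 2 * c) * (C₁ * U / (C₁ * U + 1)) by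
      field_simp]
    refine mul_le_of_le_one_right (by positivity) ((div_le_one h1).2 (by linarith))
  have hlim : Tendsto (fun β : ℝ => Real.exp (-β * (ε₁ / 2))) atTop (𝓝 0) := by
    have h0 : Tendsto (fun β : ℝ => β * (ε₁ / 2)) atTop atTop := tendsto_id.atTop_mul_const (half_pos hε₁)
    refine (Real.tendsto_exp_atBot.comp (tendsto_neg_atTop_atBot.comp h0)).congr fun β => ?_
    simp only [Function.comp_apply, neg_mul]
  obtain ⟨β₁, hβ₁⟩ := eventually_atTop.1 (hlim.eventually (gt_mem_nhds hq0))
  refine ⟨O, hOo, hKO, max β₁ 0, fun β hβ y hy => ?_⟩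
  have hβ0 : 0 ≤ β := le_trans (le_max_right _ _) hβ
  have hβ1 : β₁ ≤ β := le_trans (le_max_left _ _) hβ
  have hexpq : Real.exp (-β * (ε₁ / 2)) ≤ q := (hβ₁ β hβ1).le
  -- reduce to the defect weights: `e^{-βS} = e^{-β m} e^{-βD}`
  have hfac : ∀ x, Real.exp (-β * S (y, x)) = Real.exp (-β * m y) * Real.exp (-β * D (y, x)) := fun x => by
    rw [← Real.exp_add]; congr 1; simp only [hD]; ring
  have hL : ∫ x, g (y, x) * Real.exp (-β * S (y, x)) ∂μ =
      Real.exp (-β * m y) * ∫ x, g (y, x) * Real.exp (-β * D (y, x)) ∂μ := by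
    rw [← integral_const_mul]
    refine integral_congr_ae (ae_of_all _ fun x => ?_)
    simp only [hfac x]; ring
  have hR : ∫ x, Real.exp (-β * S (y, x)) ∂μ = Real.exp (-β * m y) * ∫ x, Real.exp (-β * D (y, x)) ∂μ := by
    rw [← integral_const_mul]
    exact integral_congr_ae (ae_of_all _ fun x => hfac x)
  rw [hL, hR, ← mul_assoc, mul_comm (r + s), mul_assoc]
  refine mul_le_mul_of_nonneg_left ?_ (Real.exp_pos _).le
  -- pointwise bound with the tail constant
  set w : X → ℝ := fun x => Real.exp (-β * D (y, x)) with hw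
  have hw_pos : ∀ x, 0 < w x := fun x => Real.exp_pos _
  have hpt : ∀ x, g (y, x) * w x ≤ (r + s / 2) * w x + C₁ * Real.exp (-β * ε₁) := fun x => by
    by_cases hx : D (y, x) ≤ ε₁
    · have h1 : g (y, x) * w x ≤ (r + s / 2) * w x :=
        mul_le_mul_of_nonneg_right (hgood y hy x hx).le (hw_pos x).le
      have h2 : 0 ≤ C₁ * Real.exp (-β * ε₁) := mul_nonneg hC₁0 (Real.exp_pos _).le
      linarith
    · have hwx : w x ≤ Real.exp (-β * ε₁) := Real.exp_le_exp.2 (by nlinarith [not_le.1 hx])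
      have h1 : (g (y, x) - (r + s / 2)) * w x ≤ C₁ * Real.exp (-β * ε₁) :=
        (le_abs_self _).trans (by
          rw [abs_mul, abs_of_pos (hw_pos x)]
          exact mul_le_mul (hgC _) hwx (hw_pos x).le hC₁0)
      linarith
  have hwc : Continuous fun p : Y × X => Real.exp (-β * D p) := Real.continuous_exp.comp (continuous_const.mul hDc)
  have hint_w : Integrable w μ := hint hwc y
  have hint_gw : Integrable (fun x => g (y, x) * w x) μ := hint (hg.mul hwc) y
  have hI : ∫ x, g (y, x) * w x ∂μ ≤ (r + s / 2) * (∫ x, w x ∂μ) + C₁ * Real.exp (-β * ε₁) * U := by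
    calc ∫ x, g (y, x) * w x ∂μ ≤ ∫ x, ((r + s / 2) * w x + C₁ * Real.exp (-β * ε₁)) ∂μ :=
          integral_mono hint_gw ((hint_w.const_mul _).add (integrable_const _)) hpt
      _ = (r + s / 2) * (∫ x, w x ∂μ) + C₁ * Real.exp (-β * ε₁) * U := by
          rw [integral_add (hint_w.const_mul _) (integrable_const _), integral_const_mul, integral_const,
            smul_eq_mul, hU]
          ring
  -- the tail is at most `(s/2) Z`
  have hZ := hZ_ge y β hβ0
  have htail : C₁ * Real.exp (-β * ε₁) * U ≤ s / 2 * ∫ x, w x ∂μ := by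
    have hsplit : Real.exp (-β * ε₁) = Real.exp (-β * (ε₁ / 2)) * Real.exp (-β * (ε₁ / 2)) := by
      rw [← Real.exp_add]; ring_nf
    calc C₁ * Real.exp (-β * ε₁) * U
        = (C₁ * U) * Real.exp (-β * (ε₁ / 2)) * Real.exp (-β * (ε₁ / 2)) := by rw [hsplit]; ring
      _ ≤ (C₁ * U) * q * Real.exp (-β * (ε₁ / 2)) := by
          refine mul_le_mul_of_nonneg_right ?_ (Real.exp_pos _).le
          exact mul_le_mul_of_nonneg_left hexpq (mul_nonneg hC₁0 hU0)
      _ ≤ (s / 2 * c) * Real.exp (-β * (ε₁ / 2)) := mul_le_mul_of_nonneg_right hqkey (Real.exp_pos _).le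
      _ = s / 2 * (c * Real.exp (-β * (ε₁ / 2))) := by ring
      _ ≤ s / 2 * ∫ x, w x ∂μ := mul_le_mul_of_nonneg_left hZ (by positivity)
  have : (r + s / 2) * (∫ x, w x ∂μ) + s / 2 * (∫ x, w x ∂μ) = (r + s) * ∫ x, w x ∂μ := by ring
  linarith

end UniformLaplace


/-! ## g5 §1∕§3 (copied verbatim from `Cruxes/IR/CruxIdea2FrameRow.lean` 7720daf266c53c8b): the rim-top twist -/

section Geometry5

variable {G : Type} [Group G]

/-- The RIM-TOP TWIST: right-multiply every vertical link based at height `b` (from `b` to `b+1`) by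
`(k (upper endpoint))⁻¹`; `k : Site 4 → G` is an arbitrary site function (read only on the site layer `b + 1`). -/
def topTwist (b : ℕ) (k : Site 4 → G) (U : LGConfig 4 G) : LGConfig 4 G :=
  fun e => if e.2 = 0 ∧ e.1 0 = (b : ℤ) then U e * (k (e.1 + Pi.single (0 : Fin 4) 1))⁻¹ else U e

/-- The layer gauge function: `k` on the site layer `x 0 = b + 1`, `1` elsewhere. -/
def layerGauge (b : ℕ) (k : Site 4 → G) : Site 4 → G :=
  fun x => if x 0 = (b : ℤ) + 1 then k x else 1

theorem add_single_apply_zero (x : Site 4) (i : Fin 4) :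
    ((x + Pi.single i (1 : ℤ) : Site 4)) 0 = x 0 + if i = 0 then 1 else 0 := by
  simp only [Pi.add_apply, Pi.single_apply]
  by_cases h : i = 0
  · subst h; simp
  · have h' : (0 : Fin 4) ≠ i := fun h0 => h h0.symm
    simp [h, h']

/-- **PROVED.** On every edge based at height `≤ b` the rim-top twist IS the gauge transformation by `layerGauge b k`. -/
theorem gaugeTransformZd_layerGauge_apply {b : ℕ} (k : Site 4 → G) (U : LGConfig 4 G) {e : ZdEdge 4}
    (he : e.1 0 ≤ (b : ℤ)) : gaugeTransformZd (layerGauge b k) U e = topTwist b k U e := by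
  have h1 : layerGauge b k e.1 = 1 := by
    unfold layerGauge; rw [if_neg]; omega
  unfold gaugeTransformZd topTwist
  rw [h1, one_mul]
  have h0 := add_single_apply_zero e.1 e.2
  by_cases hi : e.2 = 0
  · by_cases hb : e.1 0 = (b : ℤ)
    · have hmem : ((e.1 + Pi.single e.2 (1 : ℤ) : Site 4)) 0 = (b : ℤ) + 1 := by rw [h0, if_pos hi, hb]
      rw [if_pos ⟨hi, hb⟩]
      unfold layerGauge; rw [if_pos hmem, hi]
    · have hnm : ((e.1 + Pi.single e.2 (1 : ℤ) : Site 4)) 0 ≠ (b : ℤ) + 1 := by rw [h0, if_pos hi]; omega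
      rw [if_neg (fun h => hb h.2)]
      unfold layerGauge; rw [if_neg hnm, inv_one, mul_one]
  · have hnm : ((e.1 + Pi.single e.2 (1 : ℤ) : Site 4)) 0 ≠ (b : ℤ) + 1 := by rw [h0, if_neg hi]; omega
    rw [if_neg (fun h => hi h.1)]
    unfold layerGauge; rw [if_neg hnm, inv_one, mul_one]

/-- **PROVED.** Off the link layer `b` the twist changes nothing. -/
theorem topTwist_apply_of_ne {b : ℕ} (k : Site 4 → G) (U : LGConfig 4 G) {e : ZdEdge 4}
    (he : e.1 0 ≠ (b : ℤ)) : topTwist b k U e = U e := by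
  unfold topTwist; rw [if_neg (fun h => he h.2)]

/-- Heights of the edges of a cell of the standard frame. -/
theorem base_height_of_mem_cellEdges {b : ℕ} {c : Fin 4 → ℤ} {e : ZdEdge 4}
    (he : e ∈ cellEdges (stdFrame b) c) :
    (b : ℤ) * c 0 + 1 ≤ e.1 0 ∧ e.1 0 < (b : ℤ) * (c 0 + 1) + 1 := by
  have h := Fintype.mem_piFinset.1 (Finset.mem_product.1 he).1 0
  have h' := Finset.mem_Ico.1 h
  simp only [stdFrame, if_true] at h'
  exact h'

/-- **PROVED.** On every cell of the ROW LAYER (`c 0 = 0`: edges based at heights `1 … b`) the twist is the layer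
gauge transformation — the typicality of the frozen RIM cells transfers by gauge invariance. -/
theorem topTwist_eq_gauge_on_rowLayer {b : ℕ} (k : Site 4 → G) (U : LGConfig 4 G) {c : Fin 4 → ℤ}
    (hc : c 0 = 0) : ∀ e ∈ cellEdges (stdFrame b) c,
      topTwist b k U e = gaugeTransformZd (layerGauge b k) U e := by
  intro e he
  have h := base_height_of_mem_cellEdges he
  rw [hc] at h
  exact (gaugeTransformZd_layerGauge_apply k U (by linarith [h.2])).symm

/-- **PROVED.** On every cell OFF the row layer (`c 0 ≠ 0`) the twist is the identity (`1 ≤ b`). -/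
theorem topTwist_eq_self_off_rowLayer {b : ℕ} (hb : 1 ≤ b) (k : Site 4 → G) (U : LGConfig 4 G)
    {c : Fin 4 → ℤ} (hc : c 0 ≠ 0) : ∀ e ∈ cellEdges (stdFrame b) c, topTwist b k U e = U e := by
  intro e he
  have h := base_height_of_mem_cellEdges he
  refine topTwist_apply_of_ne k U fun heq => ?_
  have hb' : (1 : ℤ) ≤ b := by exact_mod_cast hb
  rcases lt_or_gt_of_ne hc with hlt | hgt
  · have : (b : ℤ) * (c 0 + 1) ≤ 0 := by nlinarith
    omega
  · have : (b : ℤ) ≤ (b : ℤ) * c 0 := by nlinarith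
    omega

/-- **PROVED (the admissibility of the pair).** The (i_T) agreement hypothesis at `Y = rowCells n`: on the window cells
off the row, `ζ` and `topTwist b k ζ` agree edge by edge (the plates are NOT conjugated). -/
theorem topTwist_agree_off_row {b n : ℕ} (hb : 1 ≤ b) (k : Site 4 → G) (ζ : LGConfig 4 G) :
    ∀ c ∈ windowCellsPlus n, c ∉ rowCells n → c ∈ windowCells n →
      ∀ e ∈ cellEdges (stdFrame b) c, ζ e = topTwist b k ζ e := by
  intro c _ hcr hcw e he
  have hc0 : c 0 ≠ 0 := fun h => hcr (Finset.mem_filter.2 ⟨hcw, h⟩)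
  exact (topTwist_eq_self_off_rowLayer hb k ζ hc0 e he).symm

/-- **PROVED (sanity anchor).** For a CONSTANT CENTRAL `g₀` the rim-top twist is the tree's layer twist at layer `b`
by `g₀⁻¹` — the present chain then IS the landed central chain (cruxidea-8) read at the top layer. -/
theorem topTwist_const_eq_layerTwist {g₀ : G} (hg : g₀ ∈ Subgroup.center G) (b : ℕ) :
    topTwist b (fun _ => g₀) = layerTwist (b : ℤ) g₀⁻¹ := by
  funext U e
  unfold topTwist layerTwist
  by_cases h : e.2 = 0 ∧ e.1 0 = (b : ℤ)
  · rw [if_pos h, if_pos h]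
    have hg' : g₀⁻¹ ∈ Subgroup.center G := Subgroup.inv_mem _ hg
    show U e * g₀⁻¹ = g₀⁻¹ * U e
    exact Subgroup.mem_center_iff.1 hg' (U e)
  · rw [if_neg h, if_neg h]

/-- The TOP RUN of the staple: `A(ζ) = ζ(top₀) ⋯ ζ(top_{m-1})` at height `b + 1` (frozen upper-plate links). -/
def topRun (b m : ℕ) (ζ : LGConfig 4 G) : G :=
  ((List.range m).map fun s : ℕ => ζ (site2 ((b : ℤ) + 1) s, 1)).prod

/-- **PROVED.** The twist leaves the top run, the bottom run, the closing link and the lower rim links alone and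
replaces the rim's top link `ζ(b,m)` by `ζ(b,m) · k(b+1,m)⁻¹`; hence the twisted staple is the untwisted one
LEFT-multiplied by the `A`-conjugate of the corner value `k (site2 (b+1) m)`. -/
theorem staple_topTwist {b : ℕ} (hb : 1 ≤ b) (m : ℕ) (k : Site 4 → G) (ζ : LGConfig 4 G) :
    staple b m (topTwist b k ζ) =
      topRun b m ζ * k (site2 ((b : ℤ) + 1) m) * (topRun b m ζ)⁻¹ * staple b m ζ := by
  have htop : ((List.range m).map fun s : ℕ => topTwist b k ζ (site2 ((b : ℤ) + 1) s, 1)) =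
      (List.range m).map fun s : ℕ => ζ (site2 ((b : ℤ) + 1) s, 1) := by
    refine List.map_congr_left fun s _ => ?_
    unfold topTwist; rw [if_neg]; simp
  have hbot : (((List.range m).reverse).map fun s : ℕ => (topTwist b k ζ (site2 0 s, 1))⁻¹) =
      ((List.range m).reverse).map fun s : ℕ => (ζ (site2 0 s, 1))⁻¹ := by
    refine List.map_congr_left fun s _ => ?_
    unfold topTwist; rw [if_neg]; simp
  have hclose : topTwist b k ζ (site2 0 0, 0) = ζ (site2 0 0, 0) := by
    refine topTwist_apply_of_ne k ζ ?_
    simp only [site2_zero]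
    have : (1 : ℤ) ≤ b := by exact_mod_cast hb
    omega
  have hdown : (((List.range (b + 1)).reverse).map fun t : ℕ => (topTwist b k ζ (site2 t m, 0))⁻¹) =
      (k (site2 ((b : ℤ) + 1) m) * (ζ (site2 b m, 0))⁻¹) ::
        (((List.range b).reverse).map fun t : ℕ => (ζ (site2 t m, 0))⁻¹) := by
    rw [List.range_succ, List.reverse_append, List.reverse_singleton, List.singleton_append, List.map_cons]
    congr 1
    · have : topTwist b k ζ (site2 b m, 0) = ζ (site2 b m, 0) * (k (site2 ((b : ℤ) + 1) m))⁻¹ := by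
        have hc : (site2 (b : ℤ) (m : ℤ), (0 : Fin 4)).2 = 0 ∧ (site2 (b : ℤ) (m : ℤ), (0 : Fin 4)).1 0 = (b : ℤ) :=
          ⟨rfl, rfl⟩
        unfold topTwist
        rw [if_pos hc]
        show ζ (site2 b m, 0) * (k (site2 (b : ℤ) (m : ℤ) + Pi.single (0 : Fin 4) 1))⁻¹ = _
        rw [site2_add_single_zero]
      rw [this, mul_inv_rev, inv_inv]
    · refine List.map_congr_left fun t ht => ?_
      rw [topTwist_apply_of_ne k ζ]
      simp only [site2_zero]
      have ht' : t < b := by simpa using ht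
      omega
  have hdown0 : (((List.range (b + 1)).reverse).map fun t : ℕ => (ζ (site2 t m, 0))⁻¹) =
      (ζ (site2 b m, 0))⁻¹ :: (((List.range b).reverse).map fun t : ℕ => (ζ (site2 t m, 0))⁻¹) := by
    rw [List.range_succ, List.reverse_append, List.reverse_singleton, List.singleton_append, List.map_cons]
  unfold staple topRun
  rw [htop, hbot, hclose, hdown, hdown0, List.prod_cons, List.prod_cons]
  set A := ((List.range m).map fun s : ℕ => ζ (site2 ((b : ℤ) + 1) s, 1)).prod
  set R := (((List.range b).reverse).map fun t : ℕ => (ζ (site2 t m, 0))⁻¹).prod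
  set Bt := (((List.range m).reverse).map fun s : ℕ => (ζ (site2 0 s, 1))⁻¹).prod
  group

end Geometry5

/-! ## §7 The layer comb and the flatness of the twisted datum (PROVED) -/

section Comb

variable {G : Type} [Group G]

/-- `ℤ⁴` line holonomy: `zline ζ ν n y = ζ(y,ν) ζ(y+e_ν,ν) ⋯ ζ(y+(n-1)e_ν,ν)`. -/
def zline (ζ : LGConfig 4 G) (ν : Fin 4) : ℕ → Site 4 → G
  | 0, _ => 1
  | n + 1, y => ζ (y, ν) * zline ζ ν n (y + Pi.single ν 1)

@[simp] theorem zline_zero (ζ : LGConfig 4 G) (ν : Fin 4) (y : Site 4) : zline ζ ν 0 y = 1 := rfl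

theorem zline_succ (ζ : LGConfig 4 G) (ν : Fin 4) (n : ℕ) (y : Site 4) :
    zline ζ ν (n + 1) y = ζ (y, ν) * zline ζ ν n (y + Pi.single ν 1) := rfl

theorem single_add_nat (ν : Fin 4) (n : ℕ) :
    (Pi.single ν (1 : ℤ) : Site 4) + Pi.single ν (n : ℤ) = Pi.single ν ((n + 1 : ℕ) : ℤ) := by
  rw [← Pi.single_add]; congr 1; push_cast; ring

/-- Appending a link at the far end. -/
theorem zline_succ_right (ζ : LGConfig 4 G) (ν : Fin 4) : ∀ (n : ℕ) (y : Site 4),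
    zline ζ ν (n + 1) y = zline ζ ν n y * ζ (y + Pi.single ν (n : ℤ), ν)
  | 0, y => by simp [zline]
  | n + 1, y => by
    rw [zline_succ, zline_succ_right ζ ν n (y + Pi.single ν 1), zline_succ, mul_assoc, add_assoc, single_add_nat]

/-- Flatness of a `ℤ⁴` configuration (all plaquette holonomies trivial). -/
def FlatZd (ζ : LGConfig 4 G) : Prop := ∀ (y : Site 4) (i j : Fin 4), plaquetteHolonomyZd ζ y i j = 1

theorem mul_eq_mul_of_flatZd {ζ : LGConfig 4 G} (hζ : FlatZd ζ) (y : Site 4) (μ ν : Fin 4) :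
    ζ (y, μ) * ζ (y + Pi.single μ 1, ν) = ζ (y, ν) * ζ (y + Pi.single ν 1, μ) := by
  have h := hζ y μ ν
  rw [plaquetteHolonomyZd, mul_inv_eq_one, mul_inv_eq_iff_eq_mul] at h
  exact h

/-- **Sliding lemma on `ℤ⁴`.** -/
theorem mul_zline_eq_of_flatZd {ζ : LGConfig 4 G} (hζ : FlatZd ζ) (μ ν : Fin 4) :
    ∀ (n : ℕ) (y : Site 4), ζ (y, μ) * zline ζ ν n (y + Pi.single μ 1) =
      zline ζ ν n y * ζ (y + Pi.single ν (n : ℤ), μ)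
  | 0, y => by simp
  | n + 1, y => by
    rw [zline_succ, zline_succ, ← mul_assoc, mul_eq_mul_of_flatZd hζ y μ ν, mul_assoc,
      show y + Pi.single μ (1 : ℤ) + Pi.single ν 1 = y + Pi.single ν 1 + Pi.single μ 1 from add_right_comm _ _ _,
      mul_zline_eq_of_flatZd hζ μ ν n (y + Pi.single ν 1), mul_assoc, add_assoc, single_add_nat]

/-- The root of the comb: the layer-`(b+1)` site `(b+1, -R, -R, -R)`. -/
def combRoot (b R : ℕ) : Site 4 := fun i => if i = 0 then (b : ℤ) + 1 else -(R : ℤ)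

/-- Number of steps of the comb path in direction `l`. -/
def combLen (R : ℕ) (x : Site 4) (l : Fin 4) : ℕ := (x l + R).toNat

/-- Start of the direction-2 segment. -/
def combPt2 (b R : ℕ) (x : Site 4) : Site 4 := combRoot b R + Pi.single 1 (combLen R x 1 : ℤ)

/-- Start of the direction-3 segment. -/
def combPt3 (b R : ℕ) (x : Site 4) : Site 4 := combPt2 b R x + Pi.single 2 (combLen R x 2 : ℤ)

/-- The STAIRCASE transport of `ζ` from the root to (the layer point below/above) `x`: `n₁` steps in direction 1,
then `n₂` in direction 2, then `n₃` in direction 3, all inside the site layer `x 0 = b + 1`. Reads only the spatial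
coordinates of `x` and only layer links. -/
def stair (b R : ℕ) (ζ : LGConfig 4 G) (x : Site 4) : G :=
  zline ζ 1 (combLen R x 1) (combRoot b R) * zline ζ 2 (combLen R x 2) (combPt2 b R x) *
    zline ζ 3 (combLen R x 3) (combPt3 b R x)

/-- THE LAYER COMB `κ_{k₀}`: `κ ζ x = stair(x)⁻¹ · k₀ · stair(x)` — the constant `k₀` transported from the root along the
staircase (so `κ ζ (root) = k₀`, and `κ ζ` is covariantly constant along every staircase link BY CONSTRUCTION and along
every layer link when `ζ` is flat). -/
def comb (b R : ℕ) (k₀ : G) (ζ : LGConfig 4 G) (x : Site 4) : G := (stair b R ζ x)⁻¹ * k₀ * stair b R ζ x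

/-- The layer region over which the comb is coherent: height `b+1`, spatial coordinates `≥ -R`. -/
def InLayer (b R : ℕ) (x : Site 4) : Prop := x 0 = (b : ℤ) + 1 ∧ ∀ l : Fin 4, l ≠ 0 → -(R : ℤ) ≤ x l

theorem combPt3_add_eq {b R : ℕ} {x : Site 4} (hx : InLayer b R x) :
    combPt3 b R x + Pi.single 3 (combLen R x 3 : ℤ) = x := by
  funext i
  have h0 := hx.1
  have h1 := hx.2 1 (by decide); have h2 := hx.2 2 (by decide); have h3 := hx.2 3 (by decide)
  simp only [combPt3, combPt2, combRoot, combLen, Pi.add_apply, Pi.single_apply]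
  fin_cases i <;> simp <;> omega

theorem combLen_add_single_self {R : ℕ} {x : Site 4} {j : Fin 4} (hj : -(R : ℤ) ≤ x j) :
    combLen R (x + Pi.single j 1) j = combLen R x j + 1 := by
  simp only [combLen, Pi.add_apply, Pi.single_eq_same]
  omega

theorem combLen_add_single_of_ne {R : ℕ} (x : Site 4) {j l : Fin 4} (h : l ≠ j) :
    combLen R (x + Pi.single j 1) l = combLen R x l := by
  simp only [combLen, Pi.add_apply, Pi.single_eq_of_ne h, add_zero]

theorem inLayer_add_single {b R : ℕ} {x : Site 4} (hx : InLayer b R x) {j : Fin 4} (hj : j ≠ 0) :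
    InLayer b R (x + Pi.single j 1) := by
  refine ⟨by rw [Pi.add_apply, Pi.single_eq_of_ne (Ne.symm hj) , add_zero]; exact hx.1, fun l hl => ?_⟩
  rw [Pi.add_apply, Pi.single_apply]
  have := hx.2 l hl
  split_ifs <;> omega

theorem single_natCast_succ (ν : Fin 4) (n : ℕ) :
    (Pi.single ν ((n + 1 : ℕ) : ℤ) : Site 4) = Pi.single ν (n : ℤ) + Pi.single ν 1 := by
  rw [← Pi.single_add]; push_cast; rfl

/-- Direction 3: pure extension of the last segment (no flatness). -/
theorem stair_add_single_three (ζ : LGConfig 4 G) {b R : ℕ} {x : Site 4} (hx : InLayer b R x) :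
    stair b R ζ (x + Pi.single 3 1) = stair b R ζ x * ζ (x, 3) := by
  have hx3 := combPt3_add_eq hx
  have e1 : combLen R (x + Pi.single 3 1) 1 = combLen R x 1 := combLen_add_single_of_ne x (by decide)
  have e2 : combLen R (x + Pi.single 3 1) 2 = combLen R x 2 := combLen_add_single_of_ne x (by decide)
  have e3 : combLen R (x + Pi.single 3 1) 3 = combLen R x 3 + 1 := combLen_add_single_self (hx.2 3 (by decide))
  have p2 : combPt2 b R (x + Pi.single 3 1) = combPt2 b R x := by simp only [combPt2, e1]
  have p3 : combPt3 b R (x + Pi.single 3 1) = combPt3 b R x := by simp only [combPt3, p2, e2]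
  unfold stair
  rw [e1, e3, p2, p3, e2, zline_succ_right, hx3]
  group

/-- Direction 2: one slide across the last segment (flatness). -/
theorem stair_add_single_two {ζ : LGConfig 4 G} (hζ : FlatZd ζ) {b R : ℕ} {x : Site 4} (hx : InLayer b R x) :
    stair b R ζ (x + Pi.single 2 1) = stair b R ζ x * ζ (x, 2) := by
  have hx3 := combPt3_add_eq hx
  have e1 : combLen R (x + Pi.single 2 1) 1 = combLen R x 1 := combLen_add_single_of_ne x (by decide)
  have e3 : combLen R (x + Pi.single 2 1) 3 = combLen R x 3 := combLen_add_single_of_ne x (by decide)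
  have e2 : combLen R (x + Pi.single 2 1) 2 = combLen R x 2 + 1 := combLen_add_single_self (hx.2 2 (by decide))
  have p2 : combPt2 b R (x + Pi.single 2 1) = combPt2 b R x := by simp only [combPt2, e1]
  have p3 : combPt3 b R (x + Pi.single 2 1) = combPt3 b R x + Pi.single 2 1 := by
    simp only [combPt3, p2, e2, single_natCast_succ, add_assoc]
  have s3 := mul_zline_eq_of_flatZd hζ 2 3 (combLen R x 3) (combPt3 b R x)
  rw [hx3] at s3
  have hp3 : combPt2 b R x + Pi.single 2 (combLen R x 2 : ℤ) = combPt3 b R x := rfl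
  unfold stair
  rw [e1, e2, e3, p2, p3, zline_succ_right, hp3]
  calc zline ζ 1 (combLen R x 1) (combRoot b R) * (zline ζ 2 (combLen R x 2) (combPt2 b R x) * ζ (combPt3 b R x, 2)) *
        zline ζ 3 (combLen R x 3) (combPt3 b R x + Pi.single 2 1)
      = zline ζ 1 (combLen R x 1) (combRoot b R) * zline ζ 2 (combLen R x 2) (combPt2 b R x) *
        (ζ (combPt3 b R x, 2) * zline ζ 3 (combLen R x 3) (combPt3 b R x + Pi.single 2 1)) := by group
    _ = _ := by rw [s3]; group

/-- Direction 1: two slides (flatness). -/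
theorem stair_add_single_one {ζ : LGConfig 4 G} (hζ : FlatZd ζ) {b R : ℕ} {x : Site 4} (hx : InLayer b R x) :
    stair b R ζ (x + Pi.single 1 1) = stair b R ζ x * ζ (x, 1) := by
  have hx3 := combPt3_add_eq hx
  have e2 : combLen R (x + Pi.single 1 1) 2 = combLen R x 2 := combLen_add_single_of_ne x (by decide)
  have e3 : combLen R (x + Pi.single 1 1) 3 = combLen R x 3 := combLen_add_single_of_ne x (by decide)
  have e1 : combLen R (x + Pi.single 1 1) 1 = combLen R x 1 + 1 := combLen_add_single_self (hx.2 1 (by decide))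
  have p2 : combPt2 b R (x + Pi.single 1 1) = combPt2 b R x + Pi.single 1 1 := by
    simp only [combPt2, e1, single_natCast_succ, add_assoc]
  have p3 : combPt3 b R (x + Pi.single 1 1) = combPt3 b R x + Pi.single 1 1 := by
    simp only [combPt3, p2, e2]; rw [add_right_comm]
  have s2 := mul_zline_eq_of_flatZd hζ 1 2 (combLen R x 2) (combPt2 b R x)
  have s3 := mul_zline_eq_of_flatZd hζ 1 3 (combLen R x 3) (combPt3 b R x)
  rw [hx3] at s3
  have hp2 : combRoot b R + Pi.single 1 (combLen R x 1 : ℤ) = combPt2 b R x := rfl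
  have hp3 : combPt2 b R x + Pi.single 2 (combLen R x 2 : ℤ) = combPt3 b R x := rfl
  rw [hp3] at s2
  unfold stair
  rw [e1, e2, e3, p2, p3, zline_succ_right, hp2]
  calc zline ζ 1 (combLen R x 1) (combRoot b R) * ζ (combPt2 b R x, 1) *
        zline ζ 2 (combLen R x 2) (combPt2 b R x + Pi.single 1 1) *
        zline ζ 3 (combLen R x 3) (combPt3 b R x + Pi.single 1 1)
      = zline ζ 1 (combLen R x 1) (combRoot b R) * (ζ (combPt2 b R x, 1) *
        zline ζ 2 (combLen R x 2) (combPt2 b R x + Pi.single 1 1)) *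
        zline ζ 3 (combLen R x 3) (combPt3 b R x + Pi.single 1 1) := by group
    _ = zline ζ 1 (combLen R x 1) (combRoot b R) * zline ζ 2 (combLen R x 2) (combPt2 b R x) *
        (ζ (combPt3 b R x, 1) * zline ζ 3 (combLen R x 3) (combPt3 b R x + Pi.single 1 1)) := by
        rw [s2]; group
    _ = _ := by rw [s3]; group

/-- **Covariant constancy of the staircase along EVERY layer link, for flat `ζ` (PROVED; discrete Stokes).** -/
theorem stair_add_single_of_flatZd {ζ : LGConfig 4 G} (hζ : FlatZd ζ) {b R : ℕ} {x : Site 4} (hx : InLayer b R x)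
    {j : Fin 4} (hj : j ≠ 0) : stair b R ζ (x + Pi.single j 1) = stair b R ζ x * ζ (x, j) := by
  have : j = 1 ∨ j = 2 ∨ j = 3 := by
    fin_cases j
    · exact absurd rfl hj
    · exact Or.inl rfl
    · exact Or.inr (Or.inl rfl)
    · exact Or.inr (Or.inr rfl)
  rcases this with rfl | rfl | rfl
  · exact stair_add_single_one hζ hx
  · exact stair_add_single_two hζ hx
  · exact stair_add_single_three ζ hx

/-- Covariant constancy of a site function `k` along the layer links over the region `InLayer b R`. -/
def LayerCov (b R : ℕ) (ζ : LGConfig 4 G) (k : Site 4 → G) : Prop :=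
  ∀ x : Site 4, InLayer b R x → ∀ j : Fin 4, j ≠ 0 → k (x + Pi.single j 1) = (ζ (x, j))⁻¹ * k x * ζ (x, j)

/-- **PROVED.** For flat `ζ` the comb is covariantly constant along every layer link of the region. -/
theorem layerCov_comb {ζ : LGConfig 4 G} (hζ : FlatZd ζ) (b R : ℕ) (k₀ : G) : LayerCov b R ζ (comb b R k₀ ζ) := by
  intro x hx j hj
  simp only [comb, stair_add_single_of_flatZd hζ hx hj, mul_inv_rev]
  group

/-- **PROVED (the twisted datum is flat).** If `ζ` is flat and `k` is covariantly constant along the layer links of the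
region, then `topTwist b k ζ` is flat at every plaquette based at a site with spatial coordinates `≥ -R`. -/
theorem flat_topTwist {ζ : LGConfig 4 G} (hζ : FlatZd ζ) {b R : ℕ} {k : Site 4 → G} (hk : LayerCov b R ζ k)
    {y : Site 4} (hy : ∀ l : Fin 4, l ≠ 0 → -(R : ℤ) ≤ y l) {i j : Fin 4} (hij : i < j) :
    plaquetteHolonomyZd (topTwist b k ζ) y i j = 1 := by
  have hj0 : j ≠ 0 := fun h => by rw [h] at hij; exact (Fin.not_lt_zero _ hij).elim
  have hyi : ((y + Pi.single i (1 : ℤ) : Site 4)) 0 = y 0 + if i = 0 then 1 else 0 := add_single_apply_zero y i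
  have hyj : ((y + Pi.single j (1 : ℤ) : Site 4)) 0 = y 0 := by rw [add_single_apply_zero, if_neg hj0, add_zero]
  rcases lt_trichotomy (y 0) (b : ℤ) with hlt | heq | hgt
  · -- all four edges based at height ≤ b : the twist is a gauge transformation there
    have hA : ∀ e : ZdEdge 4, e.1 0 ≤ (b : ℤ) → topTwist b k ζ e = gaugeTransformZd (layerGauge b k) ζ e :=
      fun e he => (gaugeTransformZd_layerGauge_apply k ζ he).symm
    have : plaquetteHolonomyZd (topTwist b k ζ) y i j = plaquetteHolonomyZd (gaugeTransformZd (layerGauge b k) ζ) y i j := by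
      unfold plaquetteHolonomyZd
      rw [hA (y, i) (by simp only; omega), hA (y + Pi.single i 1, j) (by simp only [hyi]; split_ifs <;> omega),
        hA (y + Pi.single j 1, i) (by simp only [hyj]; omega), hA (y, j) (by simp only; omega)]
    rw [this, plaquetteHolonomyZd_gaugeTransformZd, hζ y i j, mul_one, mul_inv_cancel]
  · by_cases hi0 : i = 0
    · -- the mixed temporal plaquette: covariant constancy of `k` along the layer link `(y + e₀, j)`
      subst hi0
      set x : Site 4 := y + Pi.single 0 1 with hxdef
      have hxL : InLayer b R x := ⟨by rw [hyi, if_pos rfl, heq], fun l hl => by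
        rw [hxdef, Pi.add_apply, Pi.single_eq_of_ne hl, add_zero]; exact hy l hl⟩
      have hcov := hk x hxL j hj0
      have e1 : topTwist b k ζ (y, 0) = ζ (y, 0) * (k x)⁻¹ := by unfold topTwist; rw [if_pos ⟨rfl, heq⟩]
      have e2 : topTwist b k ζ (x, j) = ζ (x, j) :=
        topTwist_apply_of_ne k ζ (by show x 0 ≠ _; rw [hxL.1]; omega)
      have e3 : topTwist b k ζ (y + Pi.single j 1, 0) = ζ (y + Pi.single j 1, 0) * (k (x + Pi.single j 1))⁻¹ := by
        unfold topTwist; rw [if_pos ⟨rfl, by show ((y + Pi.single j (1:ℤ) : Site 4)) 0 = _; rw [hyj, heq]⟩]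
        simp only [hxdef, add_right_comm y (Pi.single j 1) (Pi.single 0 1)]
      have e4 : topTwist b k ζ (y, j) = ζ (y, j) := by unfold topTwist; rw [if_neg (fun h => hj0 h.1)]
      have hflat := mul_eq_mul_of_flatZd hζ y 0 j
      rw [← hxdef] at hflat
      unfold plaquetteHolonomyZd
      rw [← hxdef, e1, e2, e3, e4, hcov]
      calc ζ (y, 0) * (k x)⁻¹ * ζ (x, j) * (ζ (y + Pi.single j 1, 0) * ((ζ (x, j))⁻¹ * k x * ζ (x, j))⁻¹)⁻¹ * (ζ (y, j))⁻¹
          = (ζ (y, 0) * ζ (x, j)) * (ζ (y + Pi.single j 1, 0))⁻¹ * (ζ (y, j))⁻¹ := by group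
        _ = 1 := by rw [hflat]; group
    · -- `y 0 = b`, both directions spatial: all four edges at height `b`
      have hA : ∀ e : ZdEdge 4, e.1 0 ≤ (b : ℤ) → topTwist b k ζ e = gaugeTransformZd (layerGauge b k) ζ e :=
        fun e he => (gaugeTransformZd_layerGauge_apply k ζ he).symm
      have : plaquetteHolonomyZd (topTwist b k ζ) y i j = plaquetteHolonomyZd (gaugeTransformZd (layerGauge b k) ζ) y i j := by
        unfold plaquetteHolonomyZd
        rw [hA (y, i) (by simp only; omega), hA (y + Pi.single i 1, j) (by simp only [hyi, if_neg hi0]; omega),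
          hA (y + Pi.single j 1, i) (by simp only [hyj]; omega), hA (y, j) (by simp only; omega)]
      rw [this, plaquetteHolonomyZd_gaugeTransformZd, hζ y i j, mul_one, mul_inv_cancel]
  · -- all four edges based at height ≥ b + 1 : the twist is the identity there
    have hB : ∀ e : ZdEdge 4, (b : ℤ) < e.1 0 → topTwist b k ζ e = ζ e := fun e he =>
      topTwist_apply_of_ne k ζ (ne_of_gt he)
    unfold plaquetteHolonomyZd
    rw [hB (y, i) (by simp only; omega), hB (y + Pi.single i 1, j) (by simp only [hyi]; split_ifs <;> omega),
      hB (y + Pi.single j 1, i) (by simp only [hyj]; omega), hB (y, j) (by simp only; omega)]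
    have := hζ y i j
    unfold plaquetteHolonomyZd at this
    exact this

end Comb


/-! ## §8 Local planar Stokes and the zero-temperature value of the twisted world (PROVED) -/

section ZeroTemp

open Literature.MathematicalPhysics.QuantumFieldTheory (GaugeConfig wilsonAction plaquetteHolonomy)
open Summit.QuantumFields.YangMills.Theorems.TunedSequenceExists.Negative.Freezing (re_trace_le_of_mem_unitaryGroup
  re_trace_eq_of_wilsonAction_eq_zero plaquetteHolonomyZd_torusLift')

variable {G : Type} [Group G] [TopologicalSpace G] [IsTopologicalGroup G] [CompactSpace G]
  [SecondCountableTopology G] [MeasurableSpace G] [BorelSpace G]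
  {N : ℕ} (ρ : G →* Matrix (Fin N) (Fin N) ℂ)

omit [TopologicalSpace G] [IsTopologicalGroup G] [CompactSpace G] [SecondCountableTopology G]
  [MeasurableSpace G] [BorelSpace G] in
/-- One flat plaquette determines its top link. -/
theorem link_of_flatAt {U : LGConfig 4 G} {t s : ℤ} (h : plaquetteHolonomyZd U (site2 t s) 0 1 = 1) :
    U (site2 (t + 1) s, 1) = (U (site2 t s, 0))⁻¹ * U (site2 t s, 1) * U (site2 t (s + 1), 0) := by
  rw [plaquetteHolonomyZd, site2_add_single_zero, site2_add_single_one] at h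
  calc U (site2 (t + 1) s, 1)
      = (U (site2 t s, 0))⁻¹ * (U (site2 t s, 0) * U (site2 (t + 1) s, 1) * (U (site2 t (s + 1), 0))⁻¹ *
          (U (site2 t s, 1))⁻¹) * U (site2 t s, 1) * U (site2 t (s + 1), 0) := by group
    _ = _ := by rw [h]; group

omit [TopologicalSpace G] [IsTopologicalGroup G] [CompactSpace G] [SecondCountableTopology G]
  [MeasurableSpace G] [BorelSpace G] in
/-- LOCAL strip Stokes: flatness only on the strip `[0,A₀) × {M}`. -/
theorem strip_eq_one_local {U : LGConfig 4 G} (M : ℕ) {A₀ : ℕ}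
    (hU : ∀ t : ℕ, t < A₀ → plaquetteHolonomyZd U (site2 t M) 0 1 = 1) : ∀ A : ℕ, A ≤ A₀ →
    upT U M A * U (site2 (A : ℤ) M, 1) * (upT U ((M : ℤ) + 1) A)⁻¹ * (U (site2 0 (M : ℤ), 1))⁻¹ = 1 := by
  intro A
  induction A with
  | zero => intro; simp
  | succ A ih =>
    intro hA
    rw [upT_succ, upT_succ]
    push_cast
    have h1 := link_of_flatAt (hU A (by omega))
    have h2 : upT U (M : ℤ) A =
        U (site2 0 (M : ℤ), 1) * upT U ((M : ℤ) + 1) A * (U (site2 (A : ℤ) (M : ℤ), 1))⁻¹ := by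
      calc upT U (M : ℤ) A
          = (upT U M A * U (site2 (A : ℤ) M, 1) * (upT U ((M : ℤ) + 1) A)⁻¹ * (U (site2 0 (M : ℤ), 1))⁻¹) *
              (U (site2 0 (M : ℤ), 1) * upT U ((M : ℤ) + 1) A * (U (site2 (A : ℤ) (M : ℤ), 1))⁻¹) := by group
        _ = _ := by rw [ih (by omega)]; group
    rw [h1, h2]
    group

omit [TopologicalSpace G] [IsTopologicalGroup G] [CompactSpace G] [SecondCountableTopology G]
  [MeasurableSpace G] [BorelSpace G] in
/-- LOCAL rectangle Stokes: flatness only on `[0,A) × [0,M₀)`. -/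
theorem rect_eq_one_local {U : LGConfig 4 G} (A : ℕ) {M₀ : ℕ}
    (hU : ∀ t s : ℕ, t < A → s < M₀ → plaquetteHolonomyZd U (site2 t s) 0 1 = 1) : ∀ M : ℕ, M ≤ M₀ →
    upT U 0 A * rightT U (A : ℤ) M * (upT U (M : ℤ) A)⁻¹ * (rightT U 0 M)⁻¹ = 1 := by
  intro M
  induction M with
  | zero => intro; simp
  | succ M ih =>
    intro hM
    rw [rightT_succ, rightT_succ]
    push_cast
    have hs := strip_eq_one_local M (fun t ht => hU t M ht (by omega)) A le_rfl
    have h1 : (upT U ((M : ℤ) + 1) A)⁻¹ =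
        (U (site2 (A : ℤ) (M : ℤ), 1))⁻¹ * (upT U (M : ℤ) A)⁻¹ * U (site2 0 (M : ℤ), 1) := by
      calc (upT U ((M : ℤ) + 1) A)⁻¹
          = (U (site2 (A : ℤ) (M : ℤ), 1))⁻¹ * (upT U (M : ℤ) A)⁻¹ *
              (upT U M A * U (site2 (A : ℤ) M, 1) * (upT U ((M : ℤ) + 1) A)⁻¹ * (U (site2 0 (M : ℤ), 1))⁻¹) *
              U (site2 0 (M : ℤ), 1) := by group
        _ = _ := by rw [hs]; group
    have h2 : upT U 0 A = rightT U 0 M * upT U (M : ℤ) A * (rightT U (A : ℤ) M)⁻¹ := by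
      calc upT U 0 A = (upT U 0 A * rightT U (A : ℤ) M * (upT U (M : ℤ) A)⁻¹ * (rightT U 0 M)⁻¹) *
            (rightT U 0 M * upT U (M : ℤ) A * (rightT U (A : ℤ) M)⁻¹) := by group
        _ = _ := by rw [ih (by omega)]; group
    rw [h1, h2]
    group

omit [TopologicalSpace G] [IsTopologicalGroup G] [CompactSpace G] [SecondCountableTopology G]
  [MeasurableSpace G] [BorelSpace G] in
/-- **LOCAL Stokes for the rectangle loop (PROVED)**: flatness on the `(b+1) × m` plaquettes of the rectangle suffices. -/
theorem col_mul_staple_eq_one_local {U : LGConfig 4 G} {b : ℕ} (hb : 1 ≤ b) (m : ℕ)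
    (hU : ∀ t s : ℕ, t < b + 1 → s < m → plaquetteHolonomyZd U (site2 t s) 0 1 = 1) :
    col b U * staple b m U = 1 := by
  have hrect := rect_eq_one_local (b + 1) hU m le_rfl
  push_cast at hrect
  rw [← mul_col_eq_upT hb U] at hrect
  rw [staple_eq_transport]
  have hcol : col b U = (U (site2 0 0, 0))⁻¹ *
      (rightT U 0 m * upT U (m : ℤ) (b + 1) * (rightT U ((b : ℤ) + 1) m)⁻¹) := by
    calc col b U = (U (site2 0 0, 0))⁻¹ * (U (site2 0 0, 0) * col b U * rightT U ((b : ℤ) + 1) m *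
          (upT U (m : ℤ) (b + 1))⁻¹ * (rightT U 0 m)⁻¹) *
          (rightT U 0 m * upT U (m : ℤ) (b + 1) * (rightT U ((b : ℤ) + 1) m)⁻¹) := by group
      _ = _ := by rw [hrect]; group
  rw [hcol]
  group

omit [TopologicalSpace G] [IsTopologicalGroup G] [CompactSpace G] [SecondCountableTopology G]
  [MeasurableSpace G] [BorelSpace G] in
/-- Zero torus action ⇒ torus-flat (all planes, faithful unitary `ρ`). -/
theorem torusFlat_of_wilsonAction_eq_zero {L : ℕ} [NeZero L] (hρu : ∀ g, ρ g ∈ Matrix.unitaryGroup (Fin N) ℂ)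
    (hρi : Function.Injective ρ) {V : GaugeConfig 4 L G} (h0 : wilsonAction ρ V = 0) :
    ∀ x (i j : Fin 4), plaquetteHolonomy V x i j = 1 := by
  have base : ∀ x (i j : Fin 4), i < j → plaquetteHolonomy V x i j = 1 := fun x i j hij => by
    have htr := re_trace_eq_of_wilsonAction_eq_zero ρ (fun g => re_trace_le_of_mem_unitaryGroup (hρu g)) h0 x i j hij
    exact hρi (by rw [Literature.Barriers.QuantumFields.eq_one_of_re_trace_eq (hρu _) htr, map_one])
  intro x i j
  rcases lt_trichotomy i j with hij | rfl | hji
  · exact base x i j hij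
  · simp [plaquetteHolonomy]
  · have h := base x j i hji
    unfold plaquetteHolonomy at h ⊢
    calc V (x, i) * V (x.shift i, j) * (V (x.shift j, i))⁻¹ * (V (x, j))⁻¹
        = (V (x, j) * V (x.shift j, i) * (V (x.shift i, j))⁻¹ * (V (x, i))⁻¹)⁻¹ := by group
      _ = 1 := by rw [h, inv_one]

omit [TopologicalSpace G] [IsTopologicalGroup G] [CompactSpace G] [SecondCountableTopology G]
  [MeasurableSpace G] [BorelSpace G] in
theorem flatZd_torusLift {L : ℕ} {V : GaugeConfig 4 L G} (hV : ∀ x (i j : Fin 4), plaquetteHolonomy V x i j = 1) :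
    FlatZd (torusLift L V) := fun y i j => by
  rw [plaquetteHolonomyZd_torusLift']; exact hV _ _ _

omit [TopologicalSpace G] [IsTopologicalGroup G] [CompactSpace G] [SecondCountableTopology G]
  [MeasurableSpace G] [BorelSpace G] in
/-- Base points of plaquettes touching the row region have spatial coordinates `≥ -S`. -/
theorem base_ge_of_mem_plaquettesTouching {b n : ℕ} {p : ZdPlaquette 4} (hp : p ∈ plaquettesTouching (rowRegion b n)) :
    ∀ l : Fin 4, l ≠ 0 → -(((2 * n + 2) * b + 1 : ℕ) : ℤ) ≤ p.1 l := by
  intro l _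
  have he : (p.1, p.2.1.1) ∈ rowRegion b n ∪ (plaquettesTouching (rowRegion b n)).biUnion plaquetteEdges :=
    Finset.mem_union_right _ (Finset.mem_biUnion.2 ⟨p, hp, by simp [plaquetteEdges]⟩)
  have hbox := rowRegion_collar_mem_box b n _ he
  rw [mem_box] at hbox
  exact (hbox l).1

omit [TopologicalSpace G] [IsTopologicalGroup G] [CompactSpace G] [SecondCountableTopology G]
  [MeasurableSpace G] [BorelSpace G] in
/-- Trace of a conjugate. -/
theorem trace_rep_conj (a g : G) : (ρ (a * g * a⁻¹)).trace = (ρ g).trace := by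
  rw [map_mul, map_mul, Matrix.trace_mul_cycle, ← map_mul, inv_mul_cancel, map_one, one_mul]

omit [TopologicalSpace G] [IsTopologicalGroup G] [CompactSpace G] [SecondCountableTopology G]
  [MeasurableSpace G] [BorelSpace G] in
/-- `Re tr ρ(g⁻¹) = Re tr ρ(g)` for unitary-valued `ρ`. -/
theorem re_trace_rep_inv (hρu : ∀ g, ρ g ∈ Matrix.unitaryGroup (Fin N) ℂ) (g : G) :
    (ρ g⁻¹).trace.re = (ρ g).trace.re := by
  have h1 : ρ g⁻¹ = star (ρ g) := by
    have hu := Matrix.mem_unitaryGroup_iff.1 (hρu g)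
    calc ρ g⁻¹ = ρ g⁻¹ * (ρ g * star (ρ g)) := by rw [hu, mul_one]
      _ = star (ρ g) := by rw [← mul_assoc, ← map_mul, inv_mul_cancel, map_one, one_mul]
  rw [h1, Matrix.star_eq_conjTranspose, Matrix.trace_conjTranspose, Complex.star_def, Complex.conj_re]

omit [TopologicalSpace G] [IsTopologicalGroup G] [CompactSpace G] [SecondCountableTopology G]
  [MeasurableSpace G] [BorelSpace G] in
/-- (c) The twisted datum has zero boundary energy on the row region. -/
theorem wilsonBoundaryAction_topTwist_eq_zero {ζ : LGConfig 4 G} (hζ : FlatZd ζ) {b n : ℕ} {k : Site 4 → G}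
    (hk : LayerCov b ((2 * n + 2) * b + 1) ζ k) :
    wilsonBoundaryAction ρ (rowRegion b n) (topTwist b k ζ) = 0 := by
  refine Finset.sum_eq_zero fun p hp => ?_
  have hflat : plaquetteHolonomyZd (topTwist b k ζ) p.1 p.2.1.1 p.2.1.2 = 1 :=
    flat_topTwist hζ hk (base_ge_of_mem_plaquettesTouching hp) p.2.2
  rw [plaquetteObs, hflat, map_one, Matrix.trace_one, Fintype.card_fin]
  simp

omit [Group G] [TopologicalSpace G] [IsTopologicalGroup G] [CompactSpace G] [SecondCountableTopology G]
  [MeasurableSpace G] [BorelSpace G] in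
theorem glueWith_self (Λ : Finset (ZdEdge 4)) (η : LGConfig 4 G) : glueWith Λ (fun e : ↥Λ => η e.1) η = η := by
  funext e
  by_cases he : e ∈ Λ
  · rw [glueWith_apply_mem _ _ _ he]
  · rw [glueWith_apply_not_mem _ _ _ he]

omit [TopologicalSpace G] [IsTopologicalGroup G] [CompactSpace G] [SecondCountableTopology G]
  [MeasurableSpace G] [BorelSpace G] in
/-- (d) Zero boundary energy ⇒ every collar plaquette is trivial (faithful unitary `ρ`). -/
theorem touching_eq_one_of_wilsonBoundaryAction_eq_zero (hρu : ∀ g, ρ g ∈ Matrix.unitaryGroup (Fin N) ℂ)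
    (hρi : Function.Injective ρ) {Λ : Finset (ZdEdge 4)} {W : LGConfig 4 G} (hW : wilsonBoundaryAction ρ Λ W = 0) :
    ∀ p ∈ plaquettesTouching Λ, plaquetteHolonomyZd W p.1 p.2.1.1 p.2.1.2 = 1 := by
  intro p hp
  have hterm0 : ∀ q ∈ plaquettesTouching Λ, 0 ≤ (N : ℝ) - plaquetteObs ρ q.1 q.2.1.1 q.2.1.2 W := fun q _ =>
    sub_nonneg.2 (re_trace_le_of_mem_unitaryGroup (hρu _))
  have h := (Finset.sum_eq_zero_iff_of_nonneg hterm0).1 hW p hp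
  have htr : (ρ (plaquetteHolonomyZd W p.1 p.2.1.1 p.2.1.2)).trace.re = N := by
    simp only [plaquetteObs] at h; linarith
  exact hρi (by rw [Literature.Barriers.QuantumFields.eq_one_of_re_trace_eq (hρu _) htr, map_one])

omit [TopologicalSpace G] [IsTopologicalGroup G] [CompactSpace G] [SecondCountableTopology G]
  [MeasurableSpace G] [BorelSpace G] in
theorem wilsonBoundaryAction_nonneg' (hρu : ∀ g, ρ g ∈ Matrix.unitaryGroup (Fin N) ℂ) (Λ : Finset (ZdEdge 4))
    (W : LGConfig 4 G) : 0 ≤ wilsonBoundaryAction ρ Λ W :=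
  Finset.sum_nonneg fun _ _ => sub_nonneg.2 (re_trace_le_of_mem_unitaryGroup (hρu _))

omit [TopologicalSpace G] [IsTopologicalGroup G] [CompactSpace G] [SecondCountableTopology G]
  [MeasurableSpace G] [BorelSpace G] in
/-- The four edges of the `(0,1)` plaquette at `site2 t s`, as members of `plaquetteEdges`. -/
theorem mem_plaquetteEdges_01 (t s : ℤ) :
    (site2 t s, (0 : Fin 4)) ∈ plaquetteEdges ((site2 t s, ⟨((0 : Fin 4), (1 : Fin 4)), by decide⟩) : ZdPlaquette 4) ∧
    (site2 t s + Pi.single 0 1, (1 : Fin 4)) ∈ plaquetteEdges ((site2 t s, ⟨((0 : Fin 4), (1 : Fin 4)), by decide⟩) : ZdPlaquette 4) ∧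
    (site2 t s + Pi.single 1 1, (0 : Fin 4)) ∈ plaquetteEdges ((site2 t s, ⟨((0 : Fin 4), (1 : Fin 4)), by decide⟩) : ZdPlaquette 4) ∧
    (site2 t s, (1 : Fin 4)) ∈ plaquetteEdges ((site2 t s, ⟨((0 : Fin 4), (1 : Fin 4)), by decide⟩) : ZdPlaquette 4) := by
  simp [plaquetteEdges]

omit [TopologicalSpace G] [IsTopologicalGroup G] [CompactSpace G] [SecondCountableTopology G]
  [MeasurableSpace G] [BorelSpace G] in
/-- (e) The rectangle plaquettes of a glued configuration with trivial collar are trivial. -/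
theorem rect_flat_of_glue {ζ : LGConfig 4 G} (hζ : FlatZd ζ) {b n : ℕ} {k : Site 4 → G}
    (hk : LayerCov b ((2 * n + 2) * b + 1) ζ k) {W : LGConfig 4 G}
    (hWoff : ∀ e, e ∉ rowRegion b n → W e = topTwist b k ζ e)
    (hWp : ∀ p ∈ plaquettesTouching (rowRegion b n), plaquetteHolonomyZd W p.1 p.2.1.1 p.2.1.2 = 1)
    (t s : ℕ) : plaquetteHolonomyZd W (site2 t s) 0 1 = 1 := by
  by_cases hp : ((site2 t s, ⟨((0 : Fin 4), (1 : Fin 4)), by decide⟩) : ZdPlaquette 4) ∈ plaquettesTouching (rowRegion b n)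
  · exact hWp _ hp
  · have hout : ∀ e ∈ plaquetteEdges ((site2 t s, ⟨((0 : Fin 4), (1 : Fin 4)), by decide⟩) : ZdPlaquette 4),
        e ∉ rowRegion b n := fun e he heΛ =>
      hp (mem_plaquettesTouching_iff.2 ⟨e, Finset.mem_inter.2 ⟨he, heΛ⟩⟩)
    have hy : ∀ l : Fin 4, l ≠ 0 → -(((2 * n + 2) * b + 1 : ℕ) : ℤ) ≤ site2 t s l := fun l hl => by
      have h1 : site2 (t : ℤ) s l = if l = 1 then (s : ℤ) else 0 := by simp [site2, hl]
      rw [h1]; split_ifs <;> omega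
    have hflat : plaquetteHolonomyZd (topTwist b k ζ) (site2 t s) 0 1 = 1 := flat_topTwist hζ hk hy (by decide)
    have h4 := mem_plaquetteEdges_01 (t : ℤ) s
    unfold plaquetteHolonomyZd at hflat ⊢
    rw [hWoff _ (hout _ h4.1), hWoff _ (hout _ h4.2.1), hWoff _ (hout _ h4.2.2.1), hWoff _ (hout _ h4.2.2.2)]
    exact hflat

omit [TopologicalSpace G] [IsTopologicalGroup G] [CompactSpace G] [SecondCountableTopology G]
  [MeasurableSpace G] [BorelSpace G] in
/-- **THE ZERO-TEMPERATURE VALUE (PROVED).**  Torus `V` flat (`S_W(V) = 0`), `ζ = lift V`, `k` covariantly constant on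
the layer region (e.g. the comb), `η' = topTwist b k ζ`; if `x` MINIMISES the boundary action of the row region glued
into `η'`, then the σ-adapted charged test of the glued configuration equals `Re tr ρ(k(corner))/N` EXACTLY:
the twisted world has a zero-energy state (the twisted datum itself), so every minimiser is flat on the collar, the
rectangle loop of the minimiser is `1` by LOCAL Stokes, its staple is the twisted staple `A·k_c·A⁻¹·staple ζ`, and the
column read against the UNtwisted staple is a conjugate of `k_c⁻¹`. -/
theorem chargedTest_re_eq_of_minimiser {ζ : LGConfig 4 G} (hζ : FlatZd ζ)
    (hρu : ∀ g, ρ g ∈ Matrix.unitaryGroup (Fin N) ℂ) (hρi : Function.Injective ρ) {b : ℕ} (hb : 1 ≤ b) (n : ℕ)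
    {k : Site 4 → G} (hk : LayerCov b ((2 * n + 2) * b + 1) ζ k) {x : ↥(rowRegion b n) → G}
    (hmin : ∀ x' : ↥(rowRegion b n) → G,
      wilsonBoundaryAction ρ (rowRegion b n) (glueWith (rowRegion b n) x (topTwist b k ζ)) ≤
        wilsonBoundaryAction ρ (rowRegion b n) (glueWith (rowRegion b n) x' (topTwist b k ζ))) :
    (chargedTest ρ b ((2 * n + 1) * b) ζ (glueWith (rowRegion b n) x (topTwist b k ζ))).re =
      (ρ (k (site2 ((b : ℤ) + 1) (((2 * n + 1) * b : ℕ) : ℤ)))).trace.re / N := by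
  have hm : (((2 * n + 1) * b : ℕ) : ℤ) = (2 * (n : ℤ) + 1) * b := by push_cast; ring
  -- (c)+(d): the minimiser has zero boundary energy, all collar plaquettes trivial
  have hS0 := wilsonBoundaryAction_topTwist_eq_zero ρ hζ (n := n) hk
  have hSW : wilsonBoundaryAction ρ (rowRegion b n) (glueWith (rowRegion b n) x (topTwist b k ζ)) = 0 := by
    refine le_antisymm ?_ (wilsonBoundaryAction_nonneg' ρ hρu _ _)
    have h := hmin (fun e => topTwist b k ζ e.1)
    rwa [glueWith_self, hS0] at h
  have hWp := touching_eq_one_of_wilsonBoundaryAction_eq_zero ρ hρu hρi hSW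
  have hWoff : ∀ e, e ∉ rowRegion b n → glueWith (rowRegion b n) x (topTwist b k ζ) e = topTwist b k ζ e :=
    fun e he => glueWith_apply_not_mem _ _ _ he
  -- (e)+(f): local Stokes
  have hloop : col b (glueWith (rowRegion b n) x (topTwist b k ζ)) *
      staple b ((2 * n + 1) * b) (glueWith (rowRegion b n) x (topTwist b k ζ)) = 1 :=
    col_mul_staple_eq_one_local hb _ fun t s _ _ => rect_flat_of_glue hζ hk hWoff hWp t s
  have hst : staple b ((2 * n + 1) * b) (glueWith (rowRegion b n) x (topTwist b k ζ)) =
      topRun b ((2 * n + 1) * b) ζ * k (site2 ((b : ℤ) + 1) (((2 * n + 1) * b : ℕ) : ℤ)) *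
        (topRun b ((2 * n + 1) * b) ζ)⁻¹ * staple b ((2 * n + 1) * b) ζ := by
    rw [staple_eq_of_eq_off_row hm hWoff, staple_topTwist hb _ k ζ]
  -- (g): the value
  set A := topRun b ((2 * n + 1) * b) ζ
  set kc := k (site2 ((b : ℤ) + 1) (((2 * n + 1) * b : ℕ) : ℤ))
  set Sζ := staple b ((2 * n + 1) * b) ζ
  have hcol : col b (glueWith (rowRegion b n) x (topTwist b k ζ)) * Sζ = (Sζ⁻¹ * A) * kc⁻¹ * (Sζ⁻¹ * A)⁻¹ := by
    have : col b (glueWith (rowRegion b n) x (topTwist b k ζ)) = (A * kc * A⁻¹ * Sζ)⁻¹ := by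
      rw [← hst]; exact eq_inv_of_mul_eq_one_left hloop
    rw [this]; group
  rw [chargedTest, hcol, trace_rep_conj, Complex.div_natCast_re, re_trace_rep_inv ρ hρu]

omit [TopologicalSpace G] [IsTopologicalGroup G] [CompactSpace G] [SecondCountableTopology G]
  [MeasurableSpace G] [BorelSpace G] in
/-- The comb instance: for a FLAT torus datum the value is `Re χ_ρ(k₀)/N`, whatever the datum. -/
theorem chargedTest_re_eq_of_minimiser_comb {L : ℕ} (hρu : ∀ g, ρ g ∈ Matrix.unitaryGroup (Fin N) ℂ)
    (hρi : Function.Injective ρ) {b : ℕ} (hb : 1 ≤ b) (n : ℕ) (k₀ : G) {V : GaugeConfig 4 L G}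
    (hV : ∀ x (i j : Fin 4), plaquetteHolonomy V x i j = 1) {x : ↥(rowRegion b n) → G}
    (hmin : ∀ x' : ↥(rowRegion b n) → G,
      wilsonBoundaryAction ρ (rowRegion b n) (glueWith (rowRegion b n) x
          (topTwist b (comb b ((2 * n + 2) * b + 1) k₀ (torusLift L V)) (torusLift L V))) ≤
        wilsonBoundaryAction ρ (rowRegion b n) (glueWith (rowRegion b n) x'
          (topTwist b (comb b ((2 * n + 2) * b + 1) k₀ (torusLift L V)) (torusLift L V)))) :
    (chargedTest ρ b ((2 * n + 1) * b) (torusLift L V)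
        (glueWith (rowRegion b n) x (topTwist b (comb b ((2 * n + 2) * b + 1) k₀ (torusLift L V)) (torusLift L V)))).re =
      (ρ k₀).trace.re / N := by
  have hζ : FlatZd (torusLift L V) := flatZd_torusLift hV
  rw [chargedTest_re_eq_of_minimiser ρ hζ hρu hρi hb n (layerCov_comb hζ _ _ k₀) hmin, comb]
  set P := stair b ((2 * n + 2) * b + 1) (torusLift L V) (site2 ((b : ℤ) + 1) (((2 * n + 1) * b : ℕ) : ℤ))
  have : P⁻¹ * k₀ * P = P⁻¹ * k₀ * P⁻¹⁻¹ := by rw [inv_inv]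
  rw [this, trace_rep_conj]

end ZeroTemp

/-! ## §9 The frame value bound for the comb twist (PROVED: input F of g5 discharged) -/

section Frame

open Literature.MathematicalPhysics.QuantumFieldTheory (wilsonMeasure GaugeConfig isProbabilityMeasure_wilsonMeasure
  wilsonAction haarProbability plaquetteHolonomy)
open Summit.QuantumFields.YangMills.Theorems.TunedSequenceExists.Negative.Freezing (tendsto_integral_wilsonMeasure
  re_trace_le_of_mem_unitaryGroup continuous_wilsonAction wilsonAction_nonneg integrable_of_continuous)

variable {G : Type} [Group G] [TopologicalSpace G] [IsTopologicalGroup G] [CompactSpace G]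
  [SecondCountableTopology G] [MeasurableSpace G] [BorelSpace G]
  {N : ℕ} (ρ : G →* Matrix (Fin N) (Fin N) ℂ)

/-! ### g5 §4 inputs (copied verbatim from `Cruxes/IR/CruxIdea2FrameRow.lean`) -/

/-- The twist map attached to a frame. -/
def twistΦ (b : ℕ) (κ : LGConfig 4 G → Site 4 → G) (ζ : LGConfig 4 G) : LGConfig 4 G := topTwist b (κ ζ) ζ

/-- **INPUT T (transfer).** -/
def TopTwistTransfer (κ : LGConfig 4 G → Site 4 → G) (b n : ℕ) : Prop :=
  ∀ (β : ℝ) (Typ : (Fin 4 → ℤ) → Set (LGConfig 4 G)),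
    (∀ c, MeasurableSet (Typ c)) →
    (∀ c, DependsOn (fun σ : LGConfig 4 G => σ ∈ Typ c) ↑(cellEdges (stdFrame b) c)) →
    ∀ c ∈ windowCellsPlus n,
      (wilsonMeasure (d := 4) (L := 2 * ((2 * n + 2) * b + 1) + 1) ρ β)
          {V | twistΦ b κ (torusLift (2 * ((2 * n + 2) * b + 1) + 1) V) ∉ Typ c} ≤
        (wilsonMeasure (d := 4) (L := 2 * ((2 * n + 2) * b + 1) + 1) ρ β)
          {V | torusLift (2 * ((2 * n + 2) * b + 1) + 1) V ∉ Typ c}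

/-- The twisted kernel mean of the `σ`-adapted charged test (real part), as a function of the torus sample. -/
def twistedMean (β : ℝ) (b n : ℕ) (κ : LGConfig 4 G → Site 4 → G)
    (V : GaugeConfig 4 (2 * ((2 * n + 2) * b + 1) + 1) G) : ℝ :=
  ∫ U, (chargedTest ρ b ((2 * n + 1) * b) (torusLift (2 * ((2 * n + 2) * b + 1) + 1) V) U).re
    ∂(ymSpecification ρ β (rowRegion b n) (twistΦ b κ (torusLift (2 * ((2 * n + 2) * b + 1) + 1) V)))

/-- **INPUT F (frame value bound).** -/
def FrameValueBound (κ : LGConfig 4 G → Site 4 → G) (b n : ℕ) (r : ℝ) : Prop :=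
  ∀ η : ℝ, 0 < η → ∃ β₀ : ℝ, ∀ β : ℝ, β₀ ≤ β →
    (wilsonMeasure (d := 4) (L := 2 * ((2 * n + 2) * b + 1) + 1) ρ β)
        {V | r + η < twistedMean ρ β b n κ V} ≤ ENNReal.ofReal η

/-! ### rev 2: shaped tests -/

/-- The twisted kernel mean of a SHAPED charged test `ψ ∘ Re` (rev 2), as a function of the torus sample. -/
def twistedMeanObs (β : ℝ) (b n : ℕ) (κ : LGConfig 4 G → Site 4 → G) (ψ : ℝ → ℝ)
    (V : GaugeConfig 4 (2 * ((2 * n + 2) * b + 1) + 1) G) : ℝ :=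
  ∫ U, ψ (chargedTest ρ b ((2 * n + 1) * b) (torusLift (2 * ((2 * n + 2) * b + 1) + 1) V) U).re
    ∂(ymSpecification ρ β (rowRegion b n) (twistΦ b κ (torusLift (2 * ((2 * n + 2) * b + 1) + 1) V)))

/-- **INPUT F for a shaped test** (rev 2): beyond `β₀(η)` the twisted mean of `ψ ∘ Re (charged test)` exceeds `v + η`
only on a set of torus mass `≤ η`.  `FrameValueBoundObs ρ κ b n (fun t => t) r` is `FrameValueBound ρ κ b n r`
(`Iff.rfl`). -/
def FrameValueBoundObs (κ : LGConfig 4 G → Site 4 → G) (b n : ℕ) (ψ : ℝ → ℝ) (v : ℝ) : Prop :=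
  ∀ η : ℝ, 0 < η → ∃ β₀ : ℝ, ∀ β : ℝ, β₀ ≤ β →
    (wilsonMeasure (d := 4) (L := 2 * ((2 * n + 2) * b + 1) + 1) ρ β)
        {V | v + η < twistedMeanObs ρ β b n κ ψ V} ≤ ENNReal.ofReal η

omit [SecondCountableTopology G] in
theorem frameValueBoundObs_id_iff (κ : LGConfig 4 G → Site 4 → G) (b n : ℕ) (r : ℝ) :
    FrameValueBoundObs ρ κ b n (fun t => t) r ↔ FrameValueBound ρ κ b n r := Iff.rfl

/-! ### continuity of the comb twist -/

omit [IsTopologicalGroup G] [CompactSpace G] [SecondCountableTopology G] [MeasurableSpace G] [BorelSpace G] in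
theorem continuous_zline [ContinuousMul G] (ν : Fin 4) :
    ∀ (n : ℕ) (y : Site 4), Continuous fun ζ : LGConfig 4 G => zline ζ ν n y
  | 0, y => by simp only [zline_zero]; exact continuous_const
  | n + 1, y => by simp only [zline_succ]; exact (continuous_apply _).mul (continuous_zline ν n _)

omit [CompactSpace G] [SecondCountableTopology G] [MeasurableSpace G] [BorelSpace G] in
theorem continuous_stair (b R : ℕ) (x : Site 4) : Continuous fun ζ : LGConfig 4 G => stair b R ζ x := by
  unfold stair
  exact ((continuous_zline 1 _ _).mul (continuous_zline 2 _ _)).mul (continuous_zline 3 _ _)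

omit [CompactSpace G] [SecondCountableTopology G] [MeasurableSpace G] [BorelSpace G] in
theorem continuous_comb (b R : ℕ) (k₀ : G) (x : Site 4) : Continuous fun ζ : LGConfig 4 G => comb b R k₀ ζ x := by
  unfold comb
  exact ((continuous_stair b R x).inv.mul continuous_const).mul (continuous_stair b R x)

omit [CompactSpace G] [SecondCountableTopology G] [MeasurableSpace G] [BorelSpace G] in
theorem continuous_twist_comb (b R : ℕ) (k₀ : G) :
    Continuous fun ζ : LGConfig 4 G => topTwist b (comb b R k₀ ζ) ζ := by
  refine continuous_pi fun e => ?_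
  by_cases he : e.2 = 0 ∧ e.1 0 = (b : ℤ)
  · simp only [topTwist, if_pos he]
    exact (continuous_apply e).mul (continuous_comb b R k₀ _).inv
  · simp only [topTwist, if_neg he]
    exact continuous_apply e

/-! ### the bound -/

/-- **F for the comb (PROVED, general torus size, general SHAPED test `ψ ∘ Re`, value `ψ (Re χ_ρ(k₀)/N)`).** -/
theorem frameValueBound_comb_aux (hρ : Continuous ρ) (hρu : ∀ g, ρ g ∈ Matrix.unitaryGroup (Fin N) ℂ)
    (hρi : Function.Injective ρ) {b : ℕ} (hb : 1 ≤ b) (n : ℕ) (k₀ : G) (L : ℕ) [NeZero L]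
    {ψ : ℝ → ℝ} (hψ : Continuous ψ) {η : ℝ} (hη : 0 < η) :
    ∃ β₀ : ℝ, ∀ β : ℝ, β₀ ≤ β →
      (wilsonMeasure (d := 4) (L := L) ρ β)
        {V | ψ ((ρ k₀).trace.re / N) + η <
          ∫ U, ψ (chargedTest ρ b ((2 * n + 1) * b) (torusLift L V) U).re
            ∂(ymSpecification ρ β (rowRegion b n)
              (topTwist b (comb b ((2 * n + 2) * b + 1) k₀ (torusLift L V)) (torusLift L V)))} ≤ ENNReal.ofReal η := by
  haveI : (haarProbability G).IsOpenPosMeasure := by unfold haarProbability; infer_instance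
  have hρN : ∀ g, (ρ g).trace.re ≤ N := fun g => re_trace_le_of_mem_unitaryGroup (hρu g)
  -- the maps
  have htw : Continuous fun V : GaugeConfig 4 L G =>
      topTwist b (comb b ((2 * n + 2) * b + 1) k₀ (torusLift L V)) (torusLift L V) :=
    (continuous_twist_comb b _ k₀).comp (continuous_torusLift L)
  have hgl : Continuous fun p : GaugeConfig 4 L G × (↥(rowRegion b n) → G) =>
      glueWith (rowRegion b n) p.2 (topTwist b (comb b ((2 * n + 2) * b + 1) k₀ (torusLift L p.1)) (torusLift L p.1)) :=
    (continuous_glueWith_prod (rowRegion b n)).comp ((htw.comp continuous_fst).prodMk continuous_snd)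
  have hS : Continuous fun p : GaugeConfig 4 L G × (↥(rowRegion b n) → G) =>
      wilsonBoundaryAction ρ (rowRegion b n) (glueWith (rowRegion b n) p.2
        (topTwist b (comb b ((2 * n + 2) * b + 1) k₀ (torusLift L p.1)) (torusLift L p.1))) :=
    (continuous_wilsonBoundaryAction ρ hρ _).comp hgl
  have hg0 : Continuous fun p : GaugeConfig 4 L G × (↥(rowRegion b n) → G) =>
      (chargedTest ρ b ((2 * n + 1) * b) (torusLift L p.1) (glueWith (rowRegion b n) p.2
        (topTwist b (comb b ((2 * n + 2) * b + 1) k₀ (torusLift L p.1)) (torusLift L p.1)))).re := by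
    unfold chargedTest
    exact Complex.continuous_re.comp (((hρ.comp (((continuous_col b).comp hgl).mul
      ((continuous_staple b _).comp ((continuous_torusLift L).comp continuous_fst)))).matrix_trace).div_const _)
  have hg : Continuous fun p : GaugeConfig 4 L G × (↥(rowRegion b n) → G) =>
      ψ (chargedTest ρ b ((2 * n + 1) * b) (torusLift L p.1) (glueWith (rowRegion b n) p.2
        (topTwist b (comb b ((2 * n + 2) * b + 1) k₀ (torusLift L p.1)) (torusLift L p.1)))).re := hψ.comp hg0
  have hK : IsClosed {V : GaugeConfig 4 L G | wilsonAction ρ V = 0} :=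
    isClosed_eq (continuous_wilsonAction ρ hρ) continuous_const
  -- the zero-temperature value at flat data
  have hmin : ∀ V ∈ {V : GaugeConfig 4 L G | wilsonAction ρ V = 0}, ∀ x : ↥(rowRegion b n) → G,
      (∀ x', (fun p : GaugeConfig 4 L G × (↥(rowRegion b n) → G) =>
        wilsonBoundaryAction ρ (rowRegion b n) (glueWith (rowRegion b n) p.2
          (topTwist b (comb b ((2 * n + 2) * b + 1) k₀ (torusLift L p.1)) (torusLift L p.1)))) (V, x) ≤
        (fun p : GaugeConfig 4 L G × (↥(rowRegion b n) → G) =>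
        wilsonBoundaryAction ρ (rowRegion b n) (glueWith (rowRegion b n) p.2
          (topTwist b (comb b ((2 * n + 2) * b + 1) k₀ (torusLift L p.1)) (torusLift L p.1)))) (V, x')) →
      (fun p : GaugeConfig 4 L G × (↥(rowRegion b n) → G) =>
        ψ (chargedTest ρ b ((2 * n + 1) * b) (torusLift L p.1) (glueWith (rowRegion b n) p.2
          (topTwist b (comb b ((2 * n + 2) * b + 1) k₀ (torusLift L p.1)) (torusLift L p.1)))).re) (V, x) ≤
        ψ ((ρ k₀).trace.re / N) := by
    intro V hV x hx
    exact (congrArg ψ (chargedTest_re_eq_of_minimiser_comb ρ hρu hρi hb n k₀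
      (torusFlat_of_wilsonAction_eq_zero ρ hρu hρi hV) hx)).le
  obtain ⟨O, hO, hKO, β₁, hβ₁⟩ :=
    laplace_upper_uniform (Measure.pi fun _ : ↥(rowRegion b n) => haarProbability G) hS hg hK hmin hη
  -- torus part: `Oᶜ` has positive minimal action, Markov + freezing
  have hθ : ∃ θ : ℝ, 0 < θ ∧ ∀ V, V ∉ O → θ ≤ wilsonAction ρ V := by
    by_cases hne : (Oᶜ : Set (GaugeConfig 4 L G)).Nonempty
    · obtain ⟨V₁, hV₁, hV₁min⟩ :=
        hO.isClosed_compl.isCompact.exists_isMinOn hne (continuous_wilsonAction ρ hρ).continuousOn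
      refine ⟨wilsonAction ρ V₁, lt_of_le_of_ne (wilsonAction_nonneg ρ hρN _) ?_, fun V hV => hV₁min hV⟩
      intro h0
      exact hV₁ (hKO h0.symm)
    · exact ⟨1, one_pos, fun V hV => (hne ⟨V, hV⟩).elim⟩
  obtain ⟨θ, hθ0, hθle⟩ := hθ
  have hT := tendsto_integral_wilsonMeasure (S := L) ρ hρ hρN (continuous_wilsonAction (S := L) ρ hρ) (c := 0)
    (fun U h => h)
  obtain ⟨β₂, hβ₂⟩ := Filter.eventually_atTop.1 (hT.eventually (gt_mem_nhds (mul_pos hθ0 hη)))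
  refine ⟨max β₁ β₂, fun β hβ => ?_⟩
  haveI := isProbabilityMeasure_wilsonMeasure (d := 4) (L := L) ρ hρ β
  -- bad set ⊆ Oᶜ
  have hsub : {V : GaugeConfig 4 L G | ψ ((ρ k₀).trace.re / N) + η <
      ∫ U, ψ (chargedTest ρ b ((2 * n + 1) * b) (torusLift L V) U).re
        ∂(ymSpecification ρ β (rowRegion b n)
          (topTwist b (comb b ((2 * n + 2) * b + 1) k₀ (torusLift L V)) (torusLift L V)))} ⊆ Oᶜ := by
    intro V hV hVO
    have hL := hβ₁ β (le_trans (le_max_left _ _) hβ) V hVO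
    have hF : Measurable fun U : LGConfig 4 G => ψ (chargedTest ρ b ((2 * n + 1) * b) (torusLift L V) U).re :=
      hψ.measurable.comp (Complex.continuous_re.comp (continuous_chargedTest ρ hρ b _ _)).measurable
    have hpos := normaliser_pos ρ hρ β (rowRegion b n)
      (topTwist b (comb b ((2 * n + 2) * b + 1) k₀ (torusLift L V)) (torusLift L V))
    have hmean : ∫ U, ψ (chargedTest ρ b ((2 * n + 1) * b) (torusLift L V) U).re
        ∂(ymSpecification ρ β (rowRegion b n)
          (topTwist b (comb b ((2 * n + 2) * b + 1) k₀ (torusLift L V)) (torusLift L V))) ≤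
        ψ ((ρ k₀).trace.re / N) + η := by
      rw [integral_ymSpecification ρ hρ β (rowRegion b n) hF, div_le_iff₀ hpos]
      exact hL
    exact absurd hV (not_lt.2 hmean)
  -- measure of `Oᶜ`
  have hint : θ * (wilsonMeasure (d := 4) (L := L) ρ β).real {V | θ ≤ wilsonAction ρ V} < θ * η :=
    lt_of_le_of_lt (mul_meas_ge_le_integral_of_nonneg (ae_of_all _ (wilsonAction_nonneg ρ hρN))
      (integrable_of_continuous _ (continuous_wilsonAction ρ hρ)) θ) (hβ₂ β (le_trans (le_max_right _ _) hβ))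
  have hreal : (wilsonMeasure (d := 4) (L := L) ρ β).real Oᶜ ≤ η :=
    le_trans (measureReal_mono (fun V hV => hθle V hV)) (lt_of_mul_lt_mul_left hint hθ0.le).le
  calc (wilsonMeasure (d := 4) (L := L) ρ β) _ ≤ (wilsonMeasure (d := 4) (L := L) ρ β) Oᶜ := measure_mono hsub
    _ = ENNReal.ofReal ((wilsonMeasure (d := 4) (L := L) ρ β).real Oᶜ) := (ofReal_measureReal (by finiteness)).symm
    _ ≤ ENNReal.ofReal η := ENNReal.ofReal_le_ofReal hreal

/-- **INPUT F DISCHARGED for the comb twist and every shaped test (PROVED, rev 2).** -/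
theorem frameValueBoundObs_comb (hρ : Continuous ρ) (hρu : ∀ g, ρ g ∈ Matrix.unitaryGroup (Fin N) ℂ)
    (hρi : Function.Injective ρ) {b : ℕ} (hb : 1 ≤ b) (n : ℕ) (k₀ : G) {ψ : ℝ → ℝ} (hψ : Continuous ψ) :
    FrameValueBoundObs ρ (comb b ((2 * n + 2) * b + 1) k₀) b n ψ (ψ ((ρ k₀).trace.re / N)) :=
  fun _ hη => frameValueBound_comb_aux ρ hρ hρu hρi hb n k₀ _ hψ hη

/-- **INPUT F DISCHARGED for the comb twist (PROVED).** -/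
theorem frameValueBound_comb (hρ : Continuous ρ) (hρu : ∀ g, ρ g ∈ Matrix.unitaryGroup (Fin N) ℂ)
    (hρi : Function.Injective ρ) {b : ℕ} (hb : 1 ≤ b) (n : ℕ) (k₀ : G) :
    FrameValueBound ρ (comb b ((2 * n + 2) * b + 1) k₀) b n ((ρ k₀).trace.re / N) :=
  fun _ hη => frameValueBound_comb_aux ρ hρ hρu hρi hb n k₀ _ (ψ := fun t => t) continuous_id hη

end Frame

/-! ## §10a Configuration-dependent gauge transformations along a gauge tree (PROVED) -/

section SkewGauge

open Literature.MathematicalPhysics.QuantumFieldTheory (GaugeConfig gaugeTransform haarProbability Edge wilsonMeasure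
  wilsonWeight wilsonAction wilsonAction_gaugeTransform)

variable {G : Type} [Group G] [TopologicalSpace G] [IsTopologicalGroup G] [CompactSpace G]
  [SecondCountableTopology G] [MeasurableSpace G] [BorelSpace G]

/-- **Skew-product lemma (PROVED).**  A CONFIGURATION-DEPENDENT gauge transformation `V ↦ V^{h(V)}` preserves the
product Haar measure provided the gauge function `h(V)` reads only the links of a set `p` of edges which the
transformation itself leaves fixed (a "gauge tree"): in the coordinates `(V|_p, V|_{pᶜ})` it is a skew product over
the identity whose fibre maps are two-sided translations link by link. -/
theorem measurePreserving_gaugeTransform_dep {d L : ℕ} [NeZero L] (p : Edge d L → Prop) [DecidablePred p]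
    (h : GaugeConfig d L G → Literature.MathematicalPhysics.QuantumFieldTheory.Site d L → G)
    (hdep : ∀ V W : GaugeConfig d L G, (∀ e, p e → V e = W e) → h V = h W)
    (hfix : ∀ (V : GaugeConfig d L G) (e : Edge d L), p e → gaugeTransform (h V) V e = V e)
    (hmeas : ∀ x, Measurable fun V => h V x) :
    MeasurePreserving (fun V : GaugeConfig d L G => gaugeTransform (h V) V)
      (Measure.pi fun _ : Edge d L => haarProbability G) (Measure.pi fun _ : Edge d L => haarProbability G) := by
  classical
  let e := MeasurableEquiv.piEquivPiSubtypeProd (fun _ : Edge d L => G) p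
  let H : ({x // p x} → G) → Literature.MathematicalPhysics.QuantumFieldTheory.Site d L → G := fun u => h (e.symm (u, fun _ => 1))
  let g : ({x // p x} → G) → ({x // ¬p x} → G) → ({x // ¬p x} → G) :=
    fun u w i => H u i.1.1 * w i * (H u (i.1.1.shift i.1.2))⁻¹
  have he : MeasurePreserving e (Measure.pi fun _ : Edge d L => haarProbability G)
      ((Measure.pi fun _ : {x // p x} => haarProbability G).prod
        (Measure.pi fun _ : {x // ¬p x} => haarProbability G)) :=
    measurePreserving_piEquivPiSubtypeProd (fun _ : Edge d L => haarProbability G) p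
  have hH : ∀ x, Measurable fun u : {x // p x} → G => H u x := fun x =>
    (hmeas x).comp (e.symm.measurable.comp (measurable_id.prodMk measurable_const))
  have hskew : MeasurePreserving
      (fun q : ({x // p x} → G) × ({x // ¬p x} → G) => (id q.1, g q.1 q.2))
      ((Measure.pi fun _ : {x // p x} => haarProbability G).prod
        (Measure.pi fun _ : {x // ¬p x} => haarProbability G))
      ((Measure.pi fun _ : {x // p x} => haarProbability G).prod
        (Measure.pi fun _ : {x // ¬p x} => haarProbability G)) := by
    refine (MeasurePreserving.id _).skew_product ?_ (ae_of_all _ fun u => ?_)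
    · refine measurable_pi_iff.2 fun i => ?_
      exact (((hH _).comp measurable_fst).mul ((measurable_pi_apply i).comp measurable_snd)).mul
        ((hH _).comp measurable_fst).inv
    · exact (measurePreserving_pi (fun _ : {x // ¬p x} => haarProbability G)
        (fun _ : {x // ¬p x} => haarProbability G)
        (f := fun (i : {x // ¬p x}) (y : G) => H u i.1.1 * y * (H u (i.1.1.shift i.1.2))⁻¹)
        fun i => Literature.MathematicalPhysics.QuantumFieldTheory.WilsonGauge.measurePreserving_mul_mul _ _).map_eq
  have hΨm : Measurable fun V : GaugeConfig d L G => gaugeTransform (h V) V :=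
    measurable_pi_iff.2 fun i => ((hmeas _).mul (measurable_pi_apply i)).mul (hmeas _).inv
  refine MeasurePreserving.of_semiconj (he.symm e) hskew (fun q => ?_) hΨm
  -- semiconjugacy: `e.symm (skew q) = Ψ (e.symm q)`
  obtain ⟨u, w⟩ := q
  have hsymm : ∀ (v : ({x // p x} → G) × ({x // ¬p x} → G)) (i : Edge d L),
      (e.symm v : GaugeConfig d L G) i = if hi : p i then v.1 ⟨i, hi⟩ else v.2 ⟨i, hi⟩ := fun v i => rfl
  have hagree : ∀ i, p i → (e.symm (u, w) : GaugeConfig d L G) i = (e.symm (u, fun _ => 1) : GaugeConfig d L G) i := by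
    intro i hi
    rw [hsymm, hsymm, dif_pos hi, dif_pos hi]
  have hh : h (e.symm (u, w)) = H u := hdep _ _ hagree
  funext i
  by_cases hi : p i
  · rw [hfix _ _ hi, hsymm, hsymm, dif_pos hi, dif_pos hi]
    rfl
  · rw [hsymm, dif_neg hi]
    show H u i.1 * w ⟨i, hi⟩ * (H u (i.1.shift i.2))⁻¹ = h (e.symm (u, w)) i.1 * (e.symm (u, w) : GaugeConfig d L G) i *
      (h (e.symm (u, w)) (i.1.shift i.2))⁻¹
    rw [hh, hsymm, dif_neg hi]

/-- The dependent gauge transformation as a measurable equivalence (inverse: the transformation by `h(V)⁻¹`). -/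
def gaugeTreeEquiv {d L : ℕ} [NeZero L] (p : Edge d L → Prop)
    (h : GaugeConfig d L G → Literature.MathematicalPhysics.QuantumFieldTheory.Site d L → G)
    (hdep : ∀ V W : GaugeConfig d L G, (∀ e, p e → V e = W e) → h V = h W)
    (hfix : ∀ (V : GaugeConfig d L G) (e : Edge d L), p e → gaugeTransform (h V) V e = V e)
    (hmeas : ∀ x, Measurable fun V => h V x) : GaugeConfig d L G ≃ᵐ GaugeConfig d L G where
  toFun V := gaugeTransform (h V) V
  invFun W := gaugeTransform (h W)⁻¹ W
  left_inv V := by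
    have hh : h (gaugeTransform (h V) V) = h V := hdep _ _ fun e he => hfix V e he
    funext e
    simp only [hh, gaugeTransform, Pi.inv_apply, inv_inv]
    group
  right_inv W := by
    have hfix' : ∀ e, p e → gaugeTransform (h W)⁻¹ W e = W e := by
      intro e he
      have h1 := hfix W e he
      simp only [gaugeTransform, Pi.inv_apply, inv_inv] at h1 ⊢
      calc (h W e.1)⁻¹ * W e * h W (e.1.shift e.2)
          = (h W e.1)⁻¹ * (h W e.1 * W e * (h W (e.1.shift e.2))⁻¹) * h W (e.1.shift e.2) := by rw [h1]
        _ = W e := by group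
    have hh : h (gaugeTransform (h W)⁻¹ W) = h W := hdep _ _ hfix'
    funext e
    simp only [hh, gaugeTransform, Pi.inv_apply, inv_inv]
    group
  measurable_toFun := measurable_pi_iff.2 fun i => ((hmeas _).mul (measurable_pi_apply i)).mul (hmeas _).inv
  measurable_invFun := measurable_pi_iff.2 fun i => ((hmeas _).inv.mul (measurable_pi_apply i)).mul
    (measurable_inv.comp (measurable_inv.comp (hmeas _)))

/-- **The Wilson measure is invariant under a tree-dependent gauge transformation (PROVED).** -/
theorem wilsonMeasure_map_gaugeTransform_dep {L N : ℕ} [NeZero L] (ρ : G →* Matrix (Fin N) (Fin N) ℂ) (β : ℝ)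
    (p : Edge 4 L → Prop) [DecidablePred p] (h : GaugeConfig 4 L G → Literature.MathematicalPhysics.QuantumFieldTheory.Site 4 L → G)
    (hdep : ∀ V W : GaugeConfig 4 L G, (∀ e, p e → V e = W e) → h V = h W)
    (hfix : ∀ (V : GaugeConfig 4 L G) (e : Edge 4 L), p e → gaugeTransform (h V) V e = V e)
    (hmeas : ∀ x, Measurable fun V => h V x) :
    (wilsonMeasure (d := 4) (L := L) ρ β).map (fun V => gaugeTransform (h V) V) =
      wilsonMeasure (d := 4) (L := L) ρ β := by
  simp only [wilsonMeasure, Measure.map_smul, wilsonWeight]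
  congr 1
  exact Literature.MathematicalPhysics.QuantumFieldTheory.WilsonGauge.withDensity_map_equiv_of_invariant _ (gaugeTreeEquiv p h hdep hfix hmeas) _
    (measurePreserving_gaugeTransform_dep p h hdep hfix hmeas).map_eq fun V => by
      show ENNReal.ofReal (Real.exp (-β * wilsonAction ρ (gaugeTransform (h V) V))) = _
      rw [wilsonAction_gaugeTransform]

end SkewGauge

/-! ## §10b The comb's gauge tree on the torus; INPUT T DISCHARGED for the comb twist (PROVED) -/

section TreeGauge

open Literature.MathematicalPhysics.QuantumFieldTheory (GaugeConfig gaugeTransform haarProbability Edge wilsonMeasure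
  wilsonAction measurable_torusLift)

variable {G : Type} [Group G] [TopologicalSpace G] [IsTopologicalGroup G] [CompactSpace G]
  [SecondCountableTopology G] [MeasurableSpace G] [BorelSpace G]
  {N : ℕ} (ρ : G →* Matrix (Fin N) (Fin N) ℂ)

omit [TopologicalSpace G] [IsTopologicalGroup G] [CompactSpace G] [SecondCountableTopology G]
  [MeasurableSpace G] [BorelSpace G] in
/-- Direction 2 from the comb spine (`x 3 = -R`): definitional extension, no flatness. -/
theorem stair_add_single_two_base (ζ : LGConfig 4 G) {b R : ℕ} {x : Site 4} (hx : InLayer b R x)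
    (h3 : combLen R x 3 = 0) : stair b R ζ (x + Pi.single 2 1) = stair b R ζ x * ζ (x, 2) := by
  have hx3 := combPt3_add_eq hx
  have e1 : combLen R (x + Pi.single 2 1) 1 = combLen R x 1 := combLen_add_single_of_ne x (by decide)
  have e3 : combLen R (x + Pi.single 2 1) 3 = combLen R x 3 := combLen_add_single_of_ne x (by decide)
  have e2 : combLen R (x + Pi.single 2 1) 2 = combLen R x 2 + 1 := combLen_add_single_self (hx.2 2 (by decide))
  have p2 : combPt2 b R (x + Pi.single 2 1) = combPt2 b R x := by simp only [combPt2, e1]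
  have p3 : combPt3 b R (x + Pi.single 2 1) = combPt3 b R x + Pi.single 2 1 := by
    simp only [combPt3, p2, e2, single_natCast_succ, add_assoc]
  have hp3 : combPt2 b R x + Pi.single 2 (combLen R x 2 : ℤ) = combPt3 b R x := rfl
  rw [h3] at hx3
  have hx3' : combPt3 b R x = x := by simpa using hx3
  unfold stair
  rw [e1, e2, e3, p2, p3, zline_succ_right, hp3, h3, zline_zero, zline_zero, mul_one, mul_one, hx3']
  simp only [mul_assoc]

omit [TopologicalSpace G] [IsTopologicalGroup G] [CompactSpace G] [SecondCountableTopology G]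
  [MeasurableSpace G] [BorelSpace G] in
/-- Direction 1 from the comb root line (`x 2 = x 3 = -R`): definitional extension, no flatness. -/
theorem stair_add_single_one_base (ζ : LGConfig 4 G) {b R : ℕ} {x : Site 4} (hx : InLayer b R x)
    (h2 : combLen R x 2 = 0) (h3 : combLen R x 3 = 0) :
    stair b R ζ (x + Pi.single 1 1) = stair b R ζ x * ζ (x, 1) := by
  have hx3 := combPt3_add_eq hx
  have e2 : combLen R (x + Pi.single 1 1) 2 = combLen R x 2 := combLen_add_single_of_ne x (by decide)
  have e3 : combLen R (x + Pi.single 1 1) 3 = combLen R x 3 := combLen_add_single_of_ne x (by decide)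
  have e1 : combLen R (x + Pi.single 1 1) 1 = combLen R x 1 + 1 := combLen_add_single_self (hx.2 1 (by decide))
  have hp2 : combRoot b R + Pi.single 1 (combLen R x 1 : ℤ) = combPt2 b R x := rfl
  have hx2 : combPt2 b R x = x := by
    have : combPt3 b R x = combPt2 b R x := by simp [combPt3, h2]
    rw [h3] at hx3; simpa [this] using hx3
  unfold stair
  rw [e1, e2, e3, h2, h3, zline_zero, zline_zero, zline_zero, zline_zero, mul_one, mul_one, mul_one, mul_one,
    zline_succ_right, hp2, hx2]

omit [TopologicalSpace G] [IsTopologicalGroup G] [CompactSpace G] [SecondCountableTopology G]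
  [MeasurableSpace G] [BorelSpace G] in
/-- A line transport reads only its own links. -/
theorem zline_congr {ζ ζ' : LGConfig 4 G} (ν : Fin 4) : ∀ (n : ℕ) (y : Site 4),
    (∀ s : ℕ, s < n → ζ (y + Pi.single ν (s : ℤ), ν) = ζ' (y + Pi.single ν (s : ℤ), ν)) →
    zline ζ ν n y = zline ζ' ν n y
  | 0, _, _ => by simp
  | n + 1, y, h => by
    rw [zline_succ, zline_succ]
    have h0 := h 0 (Nat.succ_pos n)
    simp only [Nat.cast_zero, Pi.single_zero, add_zero] at h0
    rw [h0, zline_congr ν n (y + Pi.single ν 1) fun s hs => ?_]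
    have h1 := h (s + 1) (by omega)
    rwa [← single_add_nat, ← add_assoc] at h1

/-- The comb's GAUGE TREE on the torus of side `2R+1` (read through centred representatives): the layer links in
direction 3 (except the wrapping one), in direction 2 on the spine `x₃ = -R`, in direction 1 on the root line. -/
def IsTreeEdge (b R : ℕ) (e : Edge 4 (2 * R + 1)) : Prop :=
  Torus.cRep e.1 0 = (b : ℤ) + 1 ∧
  ((e.2 = 3 ∧ Torus.cRep e.1 3 ≠ (R : ℤ)) ∨
   (e.2 = 2 ∧ Torus.cRep e.1 3 = -(R : ℤ) ∧ Torus.cRep e.1 2 ≠ (R : ℤ)) ∨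
   (e.2 = 1 ∧ Torus.cRep e.1 3 = -(R : ℤ) ∧ Torus.cRep e.1 2 = -(R : ℤ) ∧ Torus.cRep e.1 1 ≠ (R : ℤ)))

/-- The torus gauge function of the comb twist: the layer gauge of the comb, read at centred representatives. -/
def treeGauge (b R : ℕ) (k₀ : G) (V : GaugeConfig 4 (2 * R + 1) G)
    (u : Literature.MathematicalPhysics.QuantumFieldTheory.Site 4 (2 * R + 1)) : G :=
  layerGauge b (comb b R k₀ (torusLift (2 * R + 1) V)) (Torus.cRep u)

omit [TopologicalSpace G] [IsTopologicalGroup G] [CompactSpace G] [SecondCountableTopology G]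
  [MeasurableSpace G] [BorelSpace G] in
theorem cRep_bounds {R : ℕ} (u : Literature.MathematicalPhysics.QuantumFieldTheory.Site 4 (2 * R + 1)) (i : Fin 4) :
    -(R : ℤ) ≤ Torus.cRep u i ∧ Torus.cRep u i ≤ R := by
  have h := Torus.two_mul_cRepZ_bounds (L := 2 * R + 1) (u i)
  show -(R : ℤ) ≤ Torus.cRepZ (u i) ∧ Torus.cRepZ (u i) ≤ R
  push_cast at h
  omega

omit [TopologicalSpace G] [IsTopologicalGroup G] [CompactSpace G] [SecondCountableTopology G]
  [MeasurableSpace G] [BorelSpace G] in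
theorem proj_add_single (L : ℕ) (x : Site 4) (j : Fin 4) :
    Torus.proj L (x + Pi.single j 1) =
      Literature.MathematicalPhysics.QuantumFieldTheory.Site.shift (Torus.proj L x) j := by
  funext i
  simp only [Literature.MathematicalPhysics.QuantumFieldTheory.Site.shift, Torus.proj_apply, Pi.add_apply,
    Pi.single_apply, Int.cast_add]
  split_ifs <;> simp

omit [TopologicalSpace G] [IsTopologicalGroup G] [CompactSpace G] [SecondCountableTopology G]
  [MeasurableSpace G] [BorelSpace G] in
/-- A `ℤ⁴` edge in the centred box whose coordinates satisfy the tree conditions projects to a tree edge. -/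
theorem isTreeEdge_proj {b R : ℕ} {z : Site 4} (hz : ∀ i, -(R : ℤ) ≤ z i ∧ z i ≤ R) {ν : Fin 4}
    (h : z 0 = (b : ℤ) + 1 ∧ ((ν = 3 ∧ z 3 ≠ (R : ℤ)) ∨ (ν = 2 ∧ z 3 = -(R : ℤ) ∧ z 2 ≠ (R : ℤ)) ∨
      (ν = 1 ∧ z 3 = -(R : ℤ) ∧ z 2 = -(R : ℤ) ∧ z 1 ≠ (R : ℤ)))) :
    IsTreeEdge b R (Torus.proj (2 * R + 1) z, ν) := by
  unfold IsTreeEdge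
  rw [Torus.cRep_proj_of_mem_box (M := R) (by omega) (mem_box.2 hz)]
  exact h

omit [TopologicalSpace G] [IsTopologicalGroup G] [CompactSpace G] [SecondCountableTopology G]
  [MeasurableSpace G] [BorelSpace G] in
/-- **The tree gauge reads only tree links (PROVED).** -/
theorem treeGauge_dep {b R : ℕ} (hbR : b + 1 ≤ R) (k₀ : G) (V W : GaugeConfig 4 (2 * R + 1) G)
    (hVW : ∀ e, IsTreeEdge b R e → V e = W e) : treeGauge b R k₀ V = treeGauge b R k₀ W := by
  funext u
  unfold treeGauge layerGauge
  split_ifs with hx0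
  · set x := Torus.cRep u with hxdef
    have hxb : ∀ i, -(R : ℤ) ≤ x i ∧ x i ≤ R := fun i => cRep_bounds u i
    have hb1 := hxb 1; have hb2 := hxb 2; have hb3 := hxb 3
    have hlift : ∀ (U : GaugeConfig 4 (2 * R + 1) G) (z : Site 4) (ν : Fin 4),
        torusLift (2 * R + 1) U (z, ν) = U (Torus.proj (2 * R + 1) z, ν) := fun U z ν => rfl
    have hbR' : (b : ℤ) + 1 ≤ R := by exact_mod_cast hbR
    have f1 : zline (torusLift (2 * R + 1) V) 1 (combLen R x 1) (combRoot b R) =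
        zline (torusLift (2 * R + 1) W) 1 (combLen R x 1) (combRoot b R) := by
      refine zline_congr 1 _ _ fun s hs => ?_
      have hs' : (s : ℤ) < x 1 + R := by
        have : (combLen R x 1 : ℤ) = x 1 + R := by simp only [combLen]; have := hxb 1; omega
        omega
      rw [hlift, hlift]
      refine hVW _ (isTreeEdge_proj (fun i => ?_) ⟨?_, Or.inr (Or.inr ⟨rfl, ?_, ?_, ?_⟩)⟩)
      all_goals simp only [combRoot, Pi.add_apply, Pi.single_apply]
      · have := hxb 1; fin_cases i <;> simp <;> omega
      all_goals simp; try omega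
    have f2 : zline (torusLift (2 * R + 1) V) 2 (combLen R x 2) (combPt2 b R x) =
        zline (torusLift (2 * R + 1) W) 2 (combLen R x 2) (combPt2 b R x) := by
      refine zline_congr 2 _ _ fun s hs => ?_
      have hl1 : (combLen R x 1 : ℤ) = x 1 + R := by simp only [combLen]; have := hxb 1; omega
      have hs' : (s : ℤ) < x 2 + R := by
        have : (combLen R x 2 : ℤ) = x 2 + R := by simp only [combLen]; have := hxb 2; omega
        omega
      rw [hlift, hlift]
      refine hVW _ (isTreeEdge_proj (fun i => ?_) ⟨?_, Or.inr (Or.inl ⟨rfl, ?_, ?_⟩)⟩)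
      all_goals simp only [combPt2, combRoot, Pi.add_apply, Pi.single_apply]
      · have := hxb 1; have := hxb 2; fin_cases i <;> simp <;> omega
      all_goals simp; try omega
    have f3 : zline (torusLift (2 * R + 1) V) 3 (combLen R x 3) (combPt3 b R x) =
        zline (torusLift (2 * R + 1) W) 3 (combLen R x 3) (combPt3 b R x) := by
      refine zline_congr 3 _ _ fun s hs => ?_
      have hl1 : (combLen R x 1 : ℤ) = x 1 + R := by simp only [combLen]; have := hxb 1; omega
      have hl2 : (combLen R x 2 : ℤ) = x 2 + R := by simp only [combLen]; have := hxb 2; omega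
      have hs' : (s : ℤ) < x 3 + R := by
        have : (combLen R x 3 : ℤ) = x 3 + R := by simp only [combLen]; have := hxb 3; omega
        omega
      rw [hlift, hlift]
      refine hVW _ (isTreeEdge_proj (fun i => ?_) ⟨?_, Or.inl ⟨rfl, ?_⟩⟩)
      all_goals simp only [combPt3, combPt2, combRoot, Pi.add_apply, Pi.single_apply]
      · have := hxb 1; have := hxb 2; have := hxb 3; fin_cases i <;> simp <;> omega
      all_goals simp; try omega
    unfold comb stair
    rw [f1, f2, f3]
  · rfl

omit [TopologicalSpace G] [IsTopologicalGroup G] [CompactSpace G] [SecondCountableTopology G]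
  [MeasurableSpace G] [BorelSpace G] in
/-- **The comb twist fixes its tree links (PROVED; definitional covariance along the comb).** -/
theorem treeGauge_fix {b R : ℕ} (hbR : b + 1 ≤ R) (k₀ : G) (V : GaugeConfig 4 (2 * R + 1) G)
    (e : Edge 4 (2 * R + 1)) (he : IsTreeEdge b R e) : gaugeTransform (treeGauge b R k₀ V) V e = V e := by
  obtain ⟨u, j⟩ := e
  set x := Torus.cRep u with hxdef
  have hxb : ∀ i, -(R : ℤ) ≤ x i ∧ x i ≤ R := fun i => cRep_bounds u i
  obtain ⟨hx0, hbr⟩ := he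
  simp only at hx0 hbr
  rw [← hxdef] at hx0 hbr
  have hbR' : (b : ℤ) + 1 ≤ R := by exact_mod_cast hbR
  have hjR : x j < R := by
    rcases hbr with ⟨rfl, h⟩ | ⟨rfl, _, h⟩ | ⟨rfl, _, _, h⟩ <;> exact lt_of_le_of_ne (hxb _).2 h
  have hj0 : j ≠ 0 := by
    rcases hbr with ⟨rfl, _⟩ | ⟨rfl, _⟩ | ⟨rfl, _⟩ <;> decide
  have hmem : x + Pi.single j 1 ∈ box 4 R := by
    rw [mem_box]; intro i
    rw [Pi.add_apply, Pi.single_apply]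
    have := hxb i
    split_ifs with h
    · subst h; constructor <;> omega
    · simpa using this
  have hshift : Torus.cRep (Literature.MathematicalPhysics.QuantumFieldTheory.Site.shift u j) = x + Pi.single j 1 := by
    have hu : Literature.MathematicalPhysics.QuantumFieldTheory.Site.shift u j = Torus.proj (2 * R + 1) (x + Pi.single j 1) := by
      rw [proj_add_single, hxdef, Torus.proj_cRep]
    rw [hu, Torus.cRep_proj_of_mem_box (M := R) (by omega) hmem]
  have hxL : InLayer b R x := ⟨hx0, fun l _ => (hxb l).1⟩
  have hst : stair b R (torusLift (2 * R + 1) V) (x + Pi.single j 1) =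
      stair b R (torusLift (2 * R + 1) V) x * torusLift (2 * R + 1) V (x, j) := by
    rcases hbr with ⟨rfl, _⟩ | ⟨rfl, h3, _⟩ | ⟨rfl, h3, h2, _⟩
    · exact stair_add_single_three _ hxL
    · exact stair_add_single_two_base _ hxL (by simp [combLen, h3])
    · exact stair_add_single_one_base _ hxL (by simp [combLen, h2]) (by simp [combLen, h3])
  have hlink : torusLift (2 * R + 1) V (x, j) = V (u, j) := by
    show V (Torus.proj _ x, j) = V (u, j)
    rw [hxdef, Torus.proj_cRep]
  have h0' : (x + Pi.single j (1 : ℤ) : Site 4) 0 = (b : ℤ) + 1 := by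
    rw [Pi.add_apply, Pi.single_eq_of_ne (Ne.symm hj0), add_zero, hx0]
  show treeGauge b R k₀ V u * V (u, j) *
      (treeGauge b R k₀ V (Literature.MathematicalPhysics.QuantumFieldTheory.Site.shift u j))⁻¹ = V (u, j)
  have h1 : treeGauge b R k₀ V u = comb b R k₀ (torusLift (2 * R + 1) V) x := by
    simp only [treeGauge, layerGauge, ← hxdef, if_pos hx0]
  have h2 : treeGauge b R k₀ V (Literature.MathematicalPhysics.QuantumFieldTheory.Site.shift u j) =
      comb b R k₀ (torusLift (2 * R + 1) V) (x + Pi.single j 1) := by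
    simp only [treeGauge, layerGauge, hshift, if_pos h0']
  rw [h1, h2, comb, comb, hst, hlink]
  group

omit [CompactSpace G] in
/-- The tree gauge is measurable in the configuration (indeed continuous). -/
theorem measurable_treeGauge (b R : ℕ) (k₀ : G) (u : Literature.MathematicalPhysics.QuantumFieldTheory.Site 4 (2 * R + 1)) :
    Measurable fun V : GaugeConfig 4 (2 * R + 1) G => treeGauge b R k₀ V u := by
  unfold treeGauge layerGauge
  split_ifs
  · exact ((continuous_comb b R k₀ _).comp (continuous_torusLift _)).measurable
  · exact measurable_const

/-- **INPUT T DISCHARGED for the comb twist (PROVED).**  The comb-twisted periodic datum is, on every window+shell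
cell, either the datum itself (cells off the row layer) or the periodic lift of the tree-dependent gauge transform
`V ↦ V^{h(V)}` (row-layer cells, whose edges sit in the centred box), and the latter preserves the Wilson measure by the
skew-product lemma; so cell-atypicality probabilities are transported exactly. -/
theorem topTwistTransfer_comb {b : ℕ} (hb : 1 ≤ b) (n : ℕ) (k₀ : G) :
    TopTwistTransfer ρ (comb b ((2 * n + 2) * b + 1) k₀) b n := by
  classical
  intro β Typ hmeasT hdepT c hc
  set R : ℕ := (2 * n + 2) * b + 1 with hR
  have hbR : b + 1 ≤ R := by rw [hR]; nlinarith
  have hmap := wilsonMeasure_map_gaugeTransform_dep ρ β (IsTreeEdge b R) (treeGauge b R k₀)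
    (treeGauge_dep hbR k₀) (treeGauge_fix hbR k₀) (measurable_treeGauge b R k₀)
  have hΨm : Measurable fun V : GaugeConfig 4 (2 * R + 1) G => gaugeTransform (treeGauge b R k₀ V) V :=
    measurable_pi_iff.2 fun i => (((measurable_treeGauge b R k₀ _).mul (measurable_pi_apply i)).mul
      (measurable_treeGauge b R k₀ _).inv)
  have hAm : MeasurableSet {V : GaugeConfig 4 (2 * R + 1) G | torusLift (2 * R + 1) V ∉ Typ c} :=
    (hmeasT c).compl.preimage (measurable_torusLift _)
  by_cases hc0 : c 0 = 0
  · have hkey : {V : GaugeConfig 4 (2 * R + 1) G | twistΦ b (comb b R k₀) (torusLift (2 * R + 1) V) ∉ Typ c} =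
        (fun V => gaugeTransform (treeGauge b R k₀ V) V) ⁻¹'
          {V : GaugeConfig 4 (2 * R + 1) G | torusLift (2 * R + 1) V ∉ Typ c} := by
      ext V
      simp only [Set.mem_setOf_eq, Set.mem_preimage, not_iff_not]
      have hagree : ∀ e ∈ (↑(cellEdges (stdFrame b) c) : Set (ZdEdge 4)),
          twistΦ b (comb b R k₀) (torusLift (2 * R + 1) V) e =
            torusLift (2 * R + 1) (gaugeTransform (treeGauge b R k₀ V) V) e := by
        intro e he
        have hbox := cellEdges_endpoints_mem_box (S := R) le_rfl hc (Finset.mem_coe.1 he)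
        rw [twistΦ, topTwist_eq_gauge_on_rowLayer _ _ hc0 e (Finset.mem_coe.1 he),
          WilsonBlockHeatBath.torusLift_gaugeTransform]
        simp only [gaugeTransformZd, Function.comp_apply, treeGauge]
        rw [Torus.cRep_proj_of_mem_box (M := R) (by omega) hbox.1, Torus.cRep_proj_of_mem_box (M := R) (by omega) hbox.2]
      exact Iff.of_eq (hdepT c hagree)
    rw [hkey, ← Measure.map_apply hΨm hAm, hmap]
  · have hkey : {V : GaugeConfig 4 (2 * R + 1) G | twistΦ b (comb b R k₀) (torusLift (2 * R + 1) V) ∉ Typ c} =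
        {V : GaugeConfig 4 (2 * R + 1) G | torusLift (2 * R + 1) V ∉ Typ c} := by
      ext V
      simp only [Set.mem_setOf_eq, not_iff_not]
      exact Iff.of_eq (hdepT c fun e he => topTwist_eq_self_off_rowLayer hb _ _ hc0 e (Finset.mem_coe.1 he))
    rw [hkey]

end TreeGauge


section RowFormats

/-! ## §11⁰ (rev 2) The ROW formats — certideate-2's text, copied VERBATIM from `ym-19354-certideate-2/Sketch-g14.lean`
§C (b355902ce34dc08b; defs `RowClauseI`, `RowShellCondUKP`, `RowShellCond`, `RowOnsetDivergesAll`, `RowOnsetDivergesAny`,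
`RowOnsetDivergesAnyU` and the definitional lemmas), so that the theorems of §11c below are statements about THEIR
named Props (bridge = `Iff.rfl` once both files sit in one namespace). -/

open Literature.MathematicalPhysics.QuantumFieldTheory (wilsonMeasure GaugeConfig)

variable {G : Type} [Group G] [TopologicalSpace G] [IsTopologicalGroup G] [CompactSpace G]
  [MeasurableSpace G] [BorelSpace G]

/-- **Clause (i) AT THE ROW ONLY** (g8 text verbatim): sub-region mixing among typical, agreeing data asked at the
single shape `Y = rowCells n` — cell `0`'s time layer across the window, the one-cell slab sandwiched between equal
typical plates, rim typical-but-free at transverse cell-distance `n`. -/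
def RowClauseI {N : ℕ} (ρ : G →* Matrix (Fin N) (Fin N) ℂ) (β : ℝ) (w : Fin 4 → ℤ → ℤ) (n : ℕ) (ε : ℝ)
    (Typ : (Fin 4 → ℤ) → Set (LGConfig 4 G)) : Prop :=
  ∀ σ σ' : LGConfig 4 G,
    (∀ c ∈ windowCellsPlus n, c ∉ rowCells n → σ ∈ Typ c ∧ σ' ∈ Typ c) →
    (∀ c ∈ windowCellsPlus n, c ∉ rowCells n → c ∈ windowCells n → ∀ e ∈ cellEdges w c, σ e = σ' e) →
    ∀ f : LGConfig 4 G → ℝ, IsCylinder f (cellEdges w 0) → Measurable f → (∀ U, 0 ≤ f U ∧ f U ≤ 1) →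
      |(∫ U, f U ∂(ymSpecification ρ β (regionEdges w (rowCells n)) σ)) -
        ∫ U, f U ∂(ymSpecification ρ β (regionEdges w (rowCells n)) σ')| ≤ ε

/-- **PROVED (definitional).** The tree's clause (i_T) (`FixedMesh.ClauseI`, all admissible shapes `Y ∋ 0`) implies
the row clause (its instance `Y = rowCells n`). -/
theorem rowClauseI_of_clauseI {N : ℕ} {ρ : G →* Matrix (Fin N) (Fin N) ℂ} {β : ℝ} {w : Fin 4 → ℤ → ℤ} {n : ℕ}
    {ε : ℝ} {Typ : (Fin 4 → ℤ) → Set (LGConfig 4 G)} (h : FixedMesh.ClauseI ρ β w n ε Typ) :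
    RowClauseI ρ β w n ε Typ :=
  fun σ σ' hTyp hagree => h (rowCells n) (rowCells_subset n) (zero_mem_rowCells n) σ σ' hTyp hagree

/-- **The ROW FORMAT IN U CLOTHES** `RowShellCondUKP ρ β b n ε δ`: format U (`TypShellCondUKP`, slot text) with its
clause (i) replaced by `RowClauseI` (the instance `Y = rowCells n`); clauses (ii_U) (UKP joint kernel rarity) and (iii)
(torus anchor) VERBATIM — they make `Typ` co-rare, hence the row clause non-vacuous. -/
def RowShellCondUKP {N : ℕ} (ρ : G →* Matrix (Fin N) (Fin N) ℂ) (β : ℝ) (b n : ℕ) (ε δ : ℝ) : Prop :=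
  ∀ w : Fin 4 → ℤ → ℤ, (∀ i j, w i j + ((b : ℕ) : ℤ) ≤ w i (j + 1) ∧ w i (j + 1) ≤ w i j + 2 * ((b : ℕ) : ℤ)) →
    ∃ Typ : (Fin 4 → ℤ) → Set (LGConfig 4 G),
      (∀ c, MeasurableSet (Typ c)) ∧ (∀ c, DependsOn (fun σ : LGConfig 4 G => σ ∈ Typ c) ↑(cellEdges w c)) ∧
      RowClauseI ρ β w n ε Typ ∧
      (∀ F F' : Finset (Fin 4 → ℤ), F ⊆ F' → F.Nonempty → ∀ ζ : LGConfig 4 G,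
        (∀ c ∈ F, ∀ c' : Fin 4 → ℤ, (∀ i, |c' i - c i| ≤ 1) → c' ∈ F' ∨ ζ ∈ Typ c') →
          (ymSpecification ρ β (regionEdges w F') ζ) {σ : LGConfig 4 G | ∀ c ∈ F, σ ∉ Typ c} ≤
            ENNReal.ofReal (δ ^ F.card)) ∧
      (∀ S : ℕ, 4 * b ≤ 2 * S + 1 → ∀ F : Finset (Fin 4 → ℤ), F.Nonempty →
        (∀ c ∈ F, ∀ i, -(S : ℤ) ≤ w i (c i) ∧ w i (c i + 1) ≤ (S : ℤ) + 1) →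
          (wilsonMeasure (d := 4) (L := 2 * S + 1) ρ β)
              {V : GaugeConfig 4 (2 * S + 1) G | ∀ c ∈ F, torusLift (2 * S + 1) V ∉ Typ c} ≤
            ENNReal.ofReal (δ ^ F.card))

/-- **The g8 ROW FORMAT (format-T clothes)** `RowShellCond` — g8 `Sketch-g8.lean` :175 verbatim: clause (i) at the row,
(ii_T) (collar-typical joint kernel rarity) and (iii) verbatim from the registry text of format T.  Kept because the
S-port stub of §E is naturally a statement about THIS (weaker) format. -/
def RowShellCond {N : ℕ} (ρ : G →* Matrix (Fin N) (Fin N) ℂ) (β : ℝ) (b n : ℕ) (ε δ : ℝ) : Prop :=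
  ∀ w : Fin 4 → ℤ → ℤ, (∀ i j, w i j + ((b : ℕ) : ℤ) ≤ w i (j + 1) ∧ w i (j + 1) ≤ w i j + 2 * ((b : ℕ) : ℤ)) →
    ∃ Typ : (Fin 4 → ℤ) → Set (LGConfig 4 G),
      (∀ c, MeasurableSet (Typ c)) ∧ (∀ c, DependsOn (fun σ : LGConfig 4 G => σ ∈ Typ c) ↑(cellEdges w c)) ∧
      RowClauseI ρ β w n ε Typ ∧
      (∀ F F' : Finset (Fin 4 → ℤ), F ⊆ F' → F.Nonempty → ∀ ζ : LGConfig 4 G,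
        (∀ c' : Fin 4 → ℤ, c' ∉ F' → (∃ c ∈ F', ∀ i, |c' i - c i| ≤ 1) → ζ ∈ Typ c') →
          (ymSpecification ρ β (regionEdges w F') ζ) {σ : LGConfig 4 G | ∀ c ∈ F, σ ∉ Typ c} ≤
            ENNReal.ofReal (δ ^ F.card)) ∧
      (∀ S : ℕ, 4 * b ≤ 2 * S + 1 → ∀ F : Finset (Fin 4 → ℤ), F.Nonempty →
        (∀ c ∈ F, ∀ i, -(S : ℤ) ≤ w i (c i) ∧ w i (c i + 1) ≤ (S : ℤ) + 1) →
          (wilsonMeasure (d := 4) (L := 2 * S + 1) ρ β)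
              {V : GaugeConfig 4 (2 * S + 1) G | ∀ c ∈ F, torusLift (2 * S + 1) V ∉ Typ c} ≤
            ENNReal.ofReal (δ ^ F.card))

/-- **S-ROS-6 (ctriage-2's class) `RowOnsetDivergesAll ρ`** (certideate-2 text verbatim). -/
def RowOnsetDivergesAll {N : ℕ} (ρ : G →* Matrix (Fin N) (Fin N) ℂ) : Prop :=
  ConnectedSpace G → (∃ a b : G, a * b ≠ b * a) →
    Continuous ρ → Function.Injective ρ → (∀ g, ρ g ∈ Matrix.unitaryGroup (Fin N) ℂ) → 1 ≤ N →
      ∀ {b : ℕ}, 1 ≤ b → ∀ (n : ℕ) {ε δ : ℝ}, 0 ≤ ε → ε < 1 / 2 → 0 ≤ δ →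
        4 * ((windowCellsPlus n).card : ℝ) * δ < 1 →
          ∃ β₀ : ℝ, ∀ β : ℝ, β₀ ≤ β → ¬ RowShellCond ρ β b n ε δ

/-- **S-ROS-6, widest class: `RowOnsetDivergesAny ρ`** (certideate-2 text verbatim) — the same conclusion for every
compact NON-TRIVIAL `G`. -/
def RowOnsetDivergesAny {N : ℕ} (ρ : G →* Matrix (Fin N) (Fin N) ℂ) : Prop :=
  Nontrivial G →
    Continuous ρ → Function.Injective ρ → (∀ g, ρ g ∈ Matrix.unitaryGroup (Fin N) ℂ) → 1 ≤ N →
      ∀ {b : ℕ}, 1 ≤ b → ∀ (n : ℕ) {ε δ : ℝ}, 0 ≤ ε → ε < 1 / 2 → 0 ≤ δ →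
        4 * ((windowCellsPlus n).card : ℝ) * δ < 1 →
          ∃ β₀ : ℝ, ∀ β : ℝ, β₀ ≤ β → ¬ RowShellCond ρ β b n ε δ

/-- **PROVED** (certideate-2 text verbatim).  The widest-class floor implies ctriage-2's S-ROS-6. -/
theorem rowOnsetDivergesAll_of_any {N : ℕ} {ρ : G →* Matrix (Fin N) (Fin N) ℂ} (h : RowOnsetDivergesAny ρ) :
    RowOnsetDivergesAll ρ := by
  intro _ hab hc hi hu hN b hb n ε δ hε hε2 hδ hδ'
  obtain ⟨a, b', hab'⟩ := hab
  have hnt : Nontrivial G := by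
    refine ⟨⟨a, 1, fun ha => hab' ?_⟩⟩
    rw [ha, one_mul, mul_one]
  exact h hnt hc hi hu hN hb n hε hε2 hδ hδ'

/-- The widest-class floor for the U-row format (certideate-2 text verbatim). -/
def RowOnsetDivergesAnyU {N : ℕ} (ρ : G →* Matrix (Fin N) (Fin N) ℂ) : Prop :=
  Nontrivial G →
    Continuous ρ → Function.Injective ρ → (∀ g, ρ g ∈ Matrix.unitaryGroup (Fin N) ℂ) → 1 ≤ N →
      ∀ {b : ℕ}, 1 ≤ b → ∀ (n : ℕ) {ε δ : ℝ}, 0 ≤ ε → ε < 1 / 2 → 0 ≤ δ →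
        4 * ((windowCellsPlus n).card : ℝ) * δ < 1 →
          ∃ β₀ : ℝ, ∀ β : ℝ, β₀ ≤ β → ¬ RowShellCondUKP ρ β b n ε δ

end RowFormats

/-! ## §11a (g5 §2, row strength) Clause (i) at the row ⇒ two-kernel bound for admissible pairs (PROVED) -/

section TwoKernel

open Literature.MathematicalPhysics.QuantumFieldTheory (wilsonMeasure GaugeConfig isProbabilityMeasure_wilsonMeasure)

variable {G : Type} [Group G] [TopologicalSpace G] [IsTopologicalGroup G] [CompactSpace G]
  [SecondCountableTopology G] [MeasurableSpace G] [BorelSpace G]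
  {N : ℕ} (ρ : G →* Matrix (Fin N) (Fin N) ℂ)

/-- **PROVED (S).** If `Typ` satisfies clause (i_T) at the standard frame, the datum `ζ` is typical TOGETHER WITH its
rim-top twist on the cells of window+shell off the row, and `u` is a cell-0 cylinder with `|u| ≤ 1`, then the row
kernels at `ζ` and at `topTwist b k ζ` give `u` means within `2ε` (single test `f = (1+u)/2`; NO charge identity is
used — the twisted kernel is NOT a gauge image of the untwisted one). -/
theorem abs_integral_sub_le_of_rowClauseI (hρ : Continuous ρ) {β : ℝ} {b n : ℕ} (hb : 1 ≤ b) {ε : ℝ}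
    {Typ : (Fin 4 → ℤ) → Set (LGConfig 4 G)} (hI : RowClauseI ρ β (stdFrame b) n ε Typ)
    (k : Site 4 → G) {u : LGConfig 4 G → ℝ} (hum : Measurable u) (hub : ∀ U, |u U| ≤ 1)
    (hucyl : IsCylinder u (cellEdges (stdFrame b) 0)) (ζ : LGConfig 4 G)
    (hζ : ∀ c' ∈ windowCellsPlus n, c' ∉ rowCells n → ζ ∈ Typ c' ∧ topTwist b k ζ ∈ Typ c') :
    |(∫ U, u U ∂(ymSpecification ρ β (rowRegion b n) ζ)) -
        ∫ U, u U ∂(ymSpecification ρ β (rowRegion b n) (topTwist b k ζ))| ≤ 2 * ε := by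
  classical
  set μ := ymSpecification ρ β (rowRegion b n) ζ with hμ
  set μ' := ymSpecification ρ β (rowRegion b n) (topTwist b k ζ) with hμ'
  haveI : IsProbabilityMeasure μ := isProbabilityMeasure_ymSpecification ρ hρ β _ ζ
  haveI : IsProbabilityMeasure μ' := isProbabilityMeasure_ymSpecification ρ hρ β _ _
  have hcyl : IsCylinder (fun U => (1 + u U) / 2) (cellEdges (stdFrame b) 0) := by
    intro x y hxy
    show (1 + u x) / 2 = (1 + u y) / 2
    rw [hucyl hxy]
  have h01 : ∀ U, 0 ≤ (1 + u U) / 2 ∧ (1 + u U) / 2 ≤ 1 := fun U => by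
    have := abs_le.1 (hub U)
    constructor <;> linarith [this.1, this.2]
  have h : |(∫ U, (1 + u U) / 2 ∂μ) - ∫ U, (1 + u U) / 2 ∂μ'| ≤ ε :=
    hI ζ (topTwist b k ζ) hζ (topTwist_agree_off_row hb k ζ) _ hcyl ((measurable_const.add hum).div_const 2) h01
  have hi : ∀ ν : Measure (LGConfig 4 G), IsProbabilityMeasure ν → Integrable u ν := fun ν _ =>
    (integrable_const (1 : ℝ)).mono' hum.aestronglyMeasurable
      (ae_of_all _ fun U => by simpa [Real.norm_eq_abs] using hub U)
  have hshift : ∀ ν : Measure (LGConfig 4 G), IsProbabilityMeasure ν →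
      ∫ U, (1 + u U) / 2 ∂ν = (1 + ∫ U, u U ∂ν) / 2 := by
    intro ν hν
    have h1 : ∫ U, (1 + u U) ∂ν = 1 + ∫ U, u U ∂ν := by
      rw [integral_add (integrable_const _) (hi ν hν)]
      simp
    simp_rw [div_eq_mul_inv]
    rw [integral_mul_const, h1]
  rw [hshift μ inferInstance, hshift μ' inferInstance] at h
  have : (1 + ∫ U, u U ∂μ) / 2 - (1 + ∫ U, u U ∂μ') / 2 = ((∫ U, u U ∂μ) - ∫ U, u U ∂μ') / 2 := by ring
  rw [this, abs_div, abs_two] at h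
  linarith

/-- The same from the tree's full clause (i_T) (g5 statement). -/
theorem abs_integral_sub_le_of_clauseI (hρ : Continuous ρ) {β : ℝ} {b n : ℕ} (hb : 1 ≤ b) {ε : ℝ}
    {Typ : (Fin 4 → ℤ) → Set (LGConfig 4 G)} (hI : ClauseI ρ β (stdFrame b) n ε Typ)
    (k : Site 4 → G) {u : LGConfig 4 G → ℝ} (hum : Measurable u) (hub : ∀ U, |u U| ≤ 1)
    (hucyl : IsCylinder u (cellEdges (stdFrame b) 0)) (ζ : LGConfig 4 G)
    (hζ : ∀ c' ∈ windowCellsPlus n, c' ∉ rowCells n → ζ ∈ Typ c' ∧ topTwist b k ζ ∈ Typ c') :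
    |(∫ U, u U ∂(ymSpecification ρ β (rowRegion b n) ζ)) -
        ∫ U, u U ∂(ymSpecification ρ β (rowRegion b n) (topTwist b k ζ))| ≤ 2 * ε :=
  abs_integral_sub_le_of_rowClauseI ρ hρ hb (rowClauseI_of_clauseI hI) k hum hub hucyl ζ hζ

end TwoKernel

/-! ## §11b The composition (PROVED; rev 2: primitive hypotheses, shaped test) -/

section Composition

open Literature.MathematicalPhysics.QuantumFieldTheory (wilsonMeasure GaugeConfig isProbabilityMeasure_wilsonMeasure)

variable {G : Type} [Group G] [TopologicalSpace G] [IsTopologicalGroup G] [CompactSpace G]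
  [SecondCountableTopology G] [MeasurableSpace G] [BorelSpace G]
  {N : ℕ} (ρ : G →* Matrix (Fin N) (Fin N) ℂ)

/-- **PROVED (properness for shaped loops).** Under the row kernel with datum `ζ` the shaped loop IS the shaped
data-adapted charged test of `ζ` (the staple is glued to `ζ`; tree `integral_ymSpecification`, `glueWith`). -/
theorem integral_comp_loopObs_eq (hρ : Continuous ρ) (β : ℝ) {b n m : ℕ} (hm : (m : ℤ) = (2 * (n : ℤ) + 1) * b)
    {ψ : ℝ → ℝ} (hψ : Continuous ψ) (ζ : LGConfig 4 G) :
    ∫ U, ψ (loopObs ρ b m U) ∂(ymSpecification ρ β (rowRegion b n) ζ) =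
      ∫ U, ψ (chargedTest ρ b m ζ U).re ∂(ymSpecification ρ β (rowRegion b n) ζ) := by
  rw [integral_ymSpecification ρ hρ β _ (F := fun U => ψ (loopObs ρ b m U))
      (hψ.measurable.comp (continuous_loopObs ρ hρ b m).measurable),
    integral_ymSpecification ρ hρ β _ (F := fun U => ψ (chargedTest ρ b m ζ U).re)
      (hψ.measurable.comp (Complex.measurable_re.comp (measurable_chargedTest ρ hρ b m ζ)))]
  congr 1
  refine integral_congr_ae (ae_of_all _ fun ζ' => ?_)
  have hst : staple b m (glueWith (rowRegion b n) ζ' ζ) = staple b m ζ :=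
    staple_eq_of_eq_off_row hm fun e he => glueWith_apply_not_mem _ _ _ he
  simp only [loopObs, chargedTest, hst]

/-- **THE FRAME-TWIST ROW — CORE (PROVED; rev 2).**  Primitive hypotheses (a fixed `β`, a measurable cell-local class
`Typ` satisfying clause (i) AT THE ROW ONLY and the single-cell torus anchor on window+shell) and a SHAPED test
`ψ ∘ Re (charged test)`, `ψ` continuous, `|ψ| ≤ 1` on `[-1, 1]`, dominated near the frozen value: `1 − ψ t ≤ A (1 − t)`
for `t ≤ 1`; INPUT T for `κ` and INPUT F for `(κ, ψ)` with value `v`; budget `2ε < 1 − v`.  Conclusion: contradiction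
beyond `β₀ = max (freezing at 1 − s²/(A+1)) (F at s)`, `s = min ((1 − v − 2ε)/4) (1/8)`. -/
theorem frame_core (hρ : Continuous ρ) (hρi : Function.Injective ρ)
    (hρu : ∀ g, ρ g ∈ Matrix.unitaryGroup (Fin N) ℂ) (hN : 1 ≤ N)
    {b : ℕ} (hb : 1 ≤ b) (n : ℕ) (κ : LGConfig 4 G → Site 4 → G)
    {ψ : ℝ → ℝ} (hψ : Continuous ψ) (hψ1 : ∀ t, |t| ≤ 1 → |ψ t| ≤ 1)
    {A : ℝ} (hA : 0 ≤ A) (hψA : ∀ t, t ≤ 1 → 1 - ψ t ≤ A * (1 - t)) {v : ℝ}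
    (hT : TopTwistTransfer ρ κ b n) (hF : FrameValueBoundObs ρ κ b n ψ v)
    {ε δ : ℝ} (hε : 2 * ε < 1 - v) (hδ0 : 0 ≤ δ) (hδ : 4 * ((windowCellsPlus n).card : ℝ) * δ < 1) :
    ∃ β₀ : ℝ, ∀ β : ℝ, β₀ ≤ β → ∀ Typ : (Fin 4 → ℤ) → Set (LGConfig 4 G),
      (∀ c, MeasurableSet (Typ c)) →
      (∀ c, DependsOn (fun σ : LGConfig 4 G => σ ∈ Typ c) ↑(cellEdges (stdFrame b) c)) →
      RowClauseI ρ β (stdFrame b) n ε Typ →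
      (∀ c ∈ windowCellsPlus n,
        (wilsonMeasure (d := 4) (L := 2 * ((2 * n + 2) * b + 1) + 1) ρ β)
          {V | torusLift (2 * ((2 * n + 2) * b + 1) + 1) V ∉ Typ c} ≤ ENNReal.ofReal δ) → False := by
  classical
  -- budgets
  set s : ℝ := min ((1 - v - 2 * ε) / 4) (1 / 8) with hs
  have hs0 : 0 < s := lt_min (by linarith) (by norm_num)
  have hs8 : s ≤ 1 / 8 := min_le_right _ _
  have hs4 : s ≤ (1 - v - 2 * ε) / 4 := min_le_left _ _
  have hA1 : 0 < A + 1 := by linarith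
  have hss : 0 < s * s / (A + 1) := div_pos (mul_pos hs0 hs0) hA1
  -- the rectangle width and the torus
  have hm : (((2 * n + 1) * b : ℕ) : ℤ) = (2 * (n : ℤ) + 1) * b := by push_cast; ring
  obtain ⟨β₁, hβ₁⟩ := torusLoopFreezing ρ hρ hρi hρu hN hb ((2 * n + 1) * b) ((2 * n + 2) * b + 1)
    (θ := 1 - s * s / (A + 1)) (by linarith)
  obtain ⟨β₂, hβ₂⟩ := hF s hs0
  refine ⟨max β₁ β₂, fun β hβ Typ hmeas hdep hI hanch' => ?_⟩
  have hβ1 : β₁ ≤ β := (le_max_left _ _).trans hβ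
  have hβ2 : β₂ ≤ β := (le_max_right _ _).trans hβ
  set L : ℕ := 2 * ((2 * n + 2) * b + 1) + 1 with hL
  set μ := wilsonMeasure (d := 4) (L := L) ρ β with hμ
  haveI : IsProbabilityMeasure μ := isProbabilityMeasure_wilsonMeasure ρ hρ β
  set Λ := rowRegion b n with hΛ
  set m : ℕ := (2 * n + 1) * b with hmdef
  set F : LGConfig 4 G → ℝ := loopObs ρ b m with hFdef
  set Fψ : LGConfig 4 G → ℝ := fun U => ψ (loopObs ρ b m U) with hFψdef
  set Ψ : GaugeConfig 4 L G → ℝ := fun V => ∫ U, F U ∂(ymSpecification ρ β Λ (torusLift L V)) with hΨ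
  set Ψψ : GaugeConfig 4 L G → ℝ := fun V => ∫ U, Fψ U ∂(ymSpecification ρ β Λ (torusLift L V)) with hΨψ
  set Ψ' : GaugeConfig 4 L G → ℝ := twistedMeanObs ρ β b n κ ψ with hΨ'
  -- INPUT T: the twisted lifts are typical too (union bound over window+shell; outer measure, no measurability needed)
  set Ac : (Fin 4 → ℤ) → Set (GaugeConfig 4 L G) := fun c => {V | torusLift L V ∉ Typ c} with hAc
  set T : (Fin 4 → ℤ) → Set (GaugeConfig 4 L G) := fun c => {V | twistΦ b κ (torusLift L V) ∉ Typ c} with hTset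
  have hμT : ∀ c ∈ windowCellsPlus n, μ (T c) ≤ ENNReal.ofReal δ := fun c hc =>
    (hT β Typ hmeas hdep c hc).trans (hanch' c hc)
  set B : Set (GaugeConfig 4 L G) := ⋃ c ∈ windowCellsPlus n, (Ac c ∪ T c) with hB
  have hμB : μ B ≤ ENNReal.ofReal (2 * ((windowCellsPlus n).card : ℝ) * δ) := by
    calc μ B ≤ ∑ c ∈ windowCellsPlus n, μ (Ac c ∪ T c) := measure_biUnion_finset_le _ _
      _ ≤ ∑ c ∈ windowCellsPlus n, (ENNReal.ofReal δ + ENNReal.ofReal δ) :=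
          Finset.sum_le_sum fun c hc =>
            (measure_union_le _ _).trans (add_le_add (hanch' c hc) (hμT c hc))
      _ = ENNReal.ofReal (2 * ((windowCellsPlus n).card : ℝ) * δ) := by
          rw [Finset.sum_const, nsmul_eq_mul, ← ENNReal.ofReal_add hδ0 hδ0, ← ENNReal.ofReal_natCast,
            ← ENNReal.ofReal_mul (Nat.cast_nonneg _)]
          congr 1
          ring
  have hgood : ∀ V ∉ B, ∀ c ∈ windowCellsPlus n, c ∉ rowCells n →
      torusLift L V ∈ Typ c ∧ twistΦ b κ (torusLift L V) ∈ Typ c := by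
    intro V hV c hc _
    simp only [hB, Set.mem_iUnion, Set.mem_union, not_exists, not_or] at hV
    have h := hV c hc
    exact ⟨of_not_not h.1, of_not_not h.2⟩
  -- §11a on the good set: `Ψψ V − Ψ' V ≤ 2ε`
  have hF1 : ∀ U, |F U| ≤ 1 := abs_loopObs_le ρ hρu b _
  have hpair : ∀ V ∉ B, Ψψ V - Ψ' V ≤ 2 * ε := by
    intro V hV
    have hprop : Ψψ V = ∫ U, ψ (chargedTest ρ b m (torusLift L V) U).re
        ∂(ymSpecification ρ β Λ (torusLift L V)) := integral_comp_loopObs_eq ρ hρ β hm hψ _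
    have h2 := abs_integral_sub_le_of_rowClauseI ρ hρ hb hI (κ (torusLift L V))
      (u := fun U => ψ (chargedTest ρ b m (torusLift L V) U).re)
      (hψ.measurable.comp (Complex.measurable_re.comp (measurable_chargedTest ρ hρ b m _)))
      (fun U => hψ1 _ ((Complex.abs_re_le_norm _).trans (norm_chargedTest_le ρ hρu b m _ U)))
      (fun x y hxy => by
        show ψ (chargedTest ρ b m (torusLift L V) x).re = ψ (chargedTest ρ b m (torusLift L V) y).re
        rw [chargedTest_isCylinder ρ hb m _ hxy])
      (torusLift L V) (hgood V hV)
    rw [hprop]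
    exact (le_abs_self _).trans h2
  -- INPUT F: the bad-value set
  set C : Set (GaugeConfig 4 L G) := {V | v + s < Ψ' V} with hC
  have hμC : μ C ≤ ENNReal.ofReal s := hβ₂ β hβ2
  -- freezing + domination + Markov: the low-shaped-loop set
  set D : Set (GaugeConfig 4 L G) := {V | s ≤ 1 - Ψψ V} with hD
  have hFψ1 : ∀ U, |Fψ U| ≤ 1 := fun U => hψ1 _ (hF1 U)
  have hΨ1 : ∀ V, |Ψ V| ≤ 1 := fun V => abs_integral_ymSpecification_le ρ hρ β Λ hF1 _
  have hΨψ1 : ∀ V, |Ψψ V| ≤ 1 := fun V => abs_integral_ymSpecification_le ρ hρ β Λ hFψ1 _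
  have hFψc : Continuous Fψ := hψ.comp (continuous_loopObs ρ hρ b _)
  have hΨm : Measurable Ψ :=
    ((continuous_integral_ymSpecification ρ hρ β Λ (continuous_loopObs ρ hρ b _) hF1).comp
      (continuous_torusLift L)).measurable
  have hΨψm : Measurable Ψψ :=
    ((continuous_integral_ymSpecification ρ hρ β Λ hFψc hFψ1).comp (continuous_torusLift L)).measurable
  have hΨi : Integrable Ψ μ :=
    (integrable_const (1 : ℝ)).mono' hΨm.aestronglyMeasurable
      (ae_of_all _ fun V => by simpa [Real.norm_eq_abs] using hΨ1 V)
  have hΨψi : Integrable Ψψ μ :=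
    (integrable_const (1 : ℝ)).mono' hΨψm.aestronglyMeasurable
      (ae_of_all _ fun V => by simpa [Real.norm_eq_abs] using hΨψ1 V)
  have h1Ψi : Integrable (fun V => 1 - Ψ V) μ := (integrable_const _).sub hΨi
  have h1Ψψi : Integrable (fun V => 1 - Ψψ V) μ := (integrable_const _).sub hΨψi
  -- pointwise domination `1 − Ψψ ≤ A (1 − Ψ)` (the shaped loop is dominated near the frozen value)
  have hdom : ∀ V, 1 - Ψψ V ≤ A * (1 - Ψ V) := by
    intro V
    haveI : IsProbabilityMeasure (ymSpecification ρ β Λ (torusLift L V)) :=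
      isProbabilityMeasure_ymSpecification ρ hρ β _ _
    have hiF : Integrable F (ymSpecification ρ β Λ (torusLift L V)) :=
      (integrable_const (1 : ℝ)).mono' (continuous_loopObs ρ hρ b _).measurable.aestronglyMeasurable
        (ae_of_all _ fun U => by simpa [Real.norm_eq_abs] using hF1 U)
    have hiFψ : Integrable Fψ (ymSpecification ρ β Λ (torusLift L V)) :=
      (integrable_const (1 : ℝ)).mono' hFψc.measurable.aestronglyMeasurable
        (ae_of_all _ fun U => by simpa [Real.norm_eq_abs] using hFψ1 U)
    have e1 : ∫ U, (1 - Fψ U) ∂(ymSpecification ρ β Λ (torusLift L V)) =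
        1 - ∫ U, Fψ U ∂(ymSpecification ρ β Λ (torusLift L V)) := by
      rw [integral_sub (integrable_const _) hiFψ, integral_const]
      simp only [Measure.real, measure_univ, ENNReal.toReal_one, smul_eq_mul, one_mul]
    have e2 : ∫ U, A * (1 - F U) ∂(ymSpecification ρ β Λ (torusLift L V)) =
        A * (1 - ∫ U, F U ∂(ymSpecification ρ β Λ (torusLift L V))) := by
      rw [integral_const_mul, integral_sub (integrable_const _) hiF, integral_const]
      simp only [Measure.real, measure_univ, ENNReal.toReal_one, smul_eq_mul, one_mul]
    have key : ∫ U, (1 - Fψ U) ∂(ymSpecification ρ β Λ (torusLift L V)) ≤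
        ∫ U, A * (1 - F U) ∂(ymSpecification ρ β Λ (torusLift L V)) :=
      integral_mono ((integrable_const _).sub hiFψ) (((integrable_const _).sub hiF).const_mul A)
        fun U => hψA _ (abs_le.1 (hF1 U)).2
    rw [e1, e2] at key
    exact key
  have hfreeze : 1 - s * s / (A + 1) ≤ ∫ V, F (torusLift L V) ∂μ := hβ₁ β hβ1
  have hDLR : ∫ V, F (torusLift L V) ∂μ = ∫ V, Ψ V ∂μ := integral_loopObs_torus ρ hρ hρu β hm
  have hE : ∫ V, (1 - Ψ V) ∂μ ≤ s * s / (A + 1) := by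
    rw [integral_sub (integrable_const _) hΨi, integral_const]
    simp only [Measure.real, measure_univ, ENNReal.toReal_one, smul_eq_mul, one_mul]
    linarith
  have hEψ : ∫ V, (1 - Ψψ V) ∂μ ≤ s * s := by
    have h3 : A * (s * s / (A + 1)) ≤ s * s := by
      rw [mul_div_assoc', div_le_iff₀ hA1]
      nlinarith [mul_pos hs0 hs0]
    calc ∫ V, (1 - Ψψ V) ∂μ ≤ ∫ V, A * (1 - Ψ V) ∂μ := integral_mono h1Ψψi (h1Ψi.const_mul A) hdom
      _ = A * ∫ V, (1 - Ψ V) ∂μ := integral_const_mul _ _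
      _ ≤ A * (s * s / (A + 1)) := mul_le_mul_of_nonneg_left hE hA
      _ ≤ s * s := h3
  have hMarkov : s * μ.real D ≤ ∫ V, (1 - Ψψ V) ∂μ :=
    mul_meas_ge_le_integral_of_nonneg (ae_of_all _ fun V => by
      have := (abs_le.1 (hΨψ1 V)).2; show (0 : ℝ) ≤ 1 - Ψψ V; linarith) h1Ψψi s
  have hμD : μ.real D ≤ s := by
    have : s * μ.real D ≤ s * s := hMarkov.trans hEψ
    exact le_of_mul_le_mul_left this hs0
  -- the three bad sets do not cover the torus
  have hμB' : μ.real B ≤ 2 * ((windowCellsPlus n).card : ℝ) * δ :=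
    ENNReal.toReal_le_of_le_ofReal (by positivity) hμB
  have hμC' : μ.real C ≤ s := ENNReal.toReal_le_of_le_ofReal hs0.le hμC
  have hcover : μ.real (B ∪ C ∪ D) < 1 := by
    calc μ.real (B ∪ C ∪ D) ≤ μ.real (B ∪ C) + μ.real D := measureReal_union_le _ _
      _ ≤ μ.real B + μ.real C + μ.real D := by
          have := measureReal_union_le (μ := μ) B C; linarith
      _ < 1 := by nlinarith
  have hex : ∃ V, V ∉ B ∪ C ∪ D := by
    by_contra hne
    push Not at hne
    have huniv : B ∪ C ∪ D = Set.univ := Set.eq_univ_of_forall hne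
    rw [huniv] at hcover
    simp [Measure.real] at hcover
  obtain ⟨V, hV⟩ := hex
  simp only [Set.mem_union, not_or] at hV
  obtain ⟨⟨hVB, hVC⟩, hVD⟩ := hV
  have h1 : Ψψ V - Ψ' V ≤ 2 * ε := hpair V hVB
  have h2 : Ψ' V ≤ v + s := not_lt.1 hVC
  have h3 : 1 - Ψψ V < s := not_le.1 hVD
  linarith

/-- **THE FRAME-TWIST ROW (composition, g5 statement; PROVED).**  For every compact `G`, every continuous faithful
unitary `ρ` of degree `N ≥ 1`, every field-dependent rim-top twist `κ` satisfying INPUT T and INPUT F with a value `r`,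
budgets `2ε < 1 − r`, `0 ≤ δ`, `4·#windowCellsPlus(n)·δ < 1`, every mesh `b ≥ 1` and window `n`:
`∃ β₀ ∀ β ≥ β₀, ¬ TypShellCond ρ β b n ε δ`  (the core with the unshaped test `ψ = id`, `A = 1`). -/
theorem not_typShellCond_frame (hρ : Continuous ρ) (hρi : Function.Injective ρ)
    (hρu : ∀ g, ρ g ∈ Matrix.unitaryGroup (Fin N) ℂ) (hN : 1 ≤ N)
    {b : ℕ} (hb : 1 ≤ b) (n : ℕ) (κ : LGConfig 4 G → Site 4 → G) {r : ℝ}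
    (hT : TopTwistTransfer ρ κ b n) (hF : FrameValueBound ρ κ b n r)
    {ε δ : ℝ} (hε : 2 * ε < 1 - r)
    (hδ0 : 0 ≤ δ) (hδ : 4 * ((windowCellsPlus n).card : ℝ) * δ < 1) :
    ∃ β₀ : ℝ, ∀ β : ℝ, β₀ ≤ β → ¬ TypShellCond ρ β b n ε δ := by
  obtain ⟨β₀, hβ₀⟩ := frame_core ρ hρ hρi hρu hN hb n κ (ψ := fun t => t) continuous_id (fun t ht => ht)
    zero_le_one (fun t _ => by linarith) hT ((frameValueBoundObs_id_iff ρ κ b n r).2 hF) hε hδ0 hδ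
  refine ⟨β₀, fun β hβ hTyp => ?_⟩
  obtain ⟨Typ, hmeas, hdep, hI, hanch⟩ := clauseI_of_typShellCond hTyp
  exact hβ₀ β hβ Typ hmeas hdep (rowClauseI_of_clauseI hI) fun c' hc' =>
    hanch ((2 * n + 2) * b + 1) (by nlinarith) c' (stdFrame_windowCellsPlus_bounds hc')

end Composition


/-! ## §11c HEADLINE (PROVED, sorry-free): format T∕U clause (i) fails at every fixed mesh for EVERY compact `G` -/

section Headline

open Literature.MathematicalPhysics.QuantumFieldTheory (wilsonMeasure GaugeConfig isProbabilityMeasure_wilsonMeasure)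
open Summit.QuantumFields.YangMills.Theorems.TunedSequenceExists.Negative.Freezing (re_trace_le_of_mem_unitaryGroup)

variable {G : Type} [Group G] [TopologicalSpace G] [IsTopologicalGroup G] [CompactSpace G]
  [SecondCountableTopology G] [MeasurableSpace G] [BorelSpace G]
  {N : ℕ} (ρ : G →* Matrix (Fin N) (Fin N) ℂ)

omit [TopologicalSpace G] [IsTopologicalGroup G] [CompactSpace G] [SecondCountableTopology G]
  [MeasurableSpace G] [BorelSpace G] in
/-- The value of the comb-twisted row is STRICTLY below `1` for every `k₀ ≠ 1` (faithful unitary `ρ`, `N ≥ 1`): the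
budget hypothesis `2ε < 1 − Re χ_ρ(k₀)/N` of the headline is satisfiable with `ε > 0` on EVERY non-trivial compact `G`. -/
theorem re_trace_div_lt_one (hρi : Function.Injective ρ) (hρu : ∀ g, ρ g ∈ Matrix.unitaryGroup (Fin N) ℂ)
    (hN : 1 ≤ N) {k₀ : G} (hk₀ : k₀ ≠ 1) : (ρ k₀).trace.re / N < 1 := by
  have hN' : (0 : ℝ) < N := by exact_mod_cast hN
  rw [div_lt_one hN']
  refine lt_of_le_of_ne (re_trace_le_of_mem_unitaryGroup (hρu k₀)) fun h => hk₀ (hρi ?_)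
  rw [Literature.Barriers.QuantumFields.eq_one_of_re_trace_eq (hρu _) h, map_one]

/-- **HEADLINE — THE FIXED-MESH NEGATIVE FOR EVERY COMPACT GAUGE GROUP (PROVED, sorry-free).**  For every compact
(second countable) `G`, every continuous faithful unitary `ρ` of degree `N ≥ 1`, every `k₀ : G`, mesh `b ≥ 1`, window
`n`, and budgets `2ε < 1 − Re χ_ρ(k₀)/N` (satisfiable with `ε > 0` as soon as `k₀ ≠ 1`, `re_trace_div_lt_one`), `0 ≤ δ`,
`4·#windowCellsPlus(n)·δ < 1`:  `∃ β₀ ∀ β ≥ β₀, ¬ TypShellCond ρ β b n ε δ`.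
NO centre and NO scalar hypothesis (`ρ g₀ = c • 1`) — the tree's `not_typShellCond_fixedMesh` needs both; this covers
the centre-free groups `SO(3)`, `G₂`, `F₄`, `E₈`, `PSU(N)` and every faithful representation.  Proof: the g5 composition
`not_typShellCond_frame` with the LAYER-COMB twist `κ = comb b ((2n+2)b+1) k₀`, whose two inputs are the theorems
`topTwistTransfer_comb` (INPUT T, §10: skew-product Fubini along the comb's gauge tree) and `frameValueBound_comb`
(INPUT F, §9: uniform soft Laplace principle + zero-temperature Stokes algebra + torus plaquette freezing). -/
theorem not_typShellCond_fixedMesh_allG (hρ : Continuous ρ) (hρi : Function.Injective ρ)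
    (hρu : ∀ g, ρ g ∈ Matrix.unitaryGroup (Fin N) ℂ) (hN : 1 ≤ N) (k₀ : G)
    {b : ℕ} (hb : 1 ≤ b) (n : ℕ) {ε δ : ℝ} (hε : 2 * ε < 1 - (ρ k₀).trace.re / N)
    (hδ0 : 0 ≤ δ) (hδ : 4 * ((windowCellsPlus n).card : ℝ) * δ < 1) :
    ∃ β₀ : ℝ, ∀ β : ℝ, β₀ ≤ β → ¬ TypShellCond ρ β b n ε δ :=
  not_typShellCond_frame ρ hρ hρi hρu hN hb n (comb b ((2 * n + 2) * b + 1) k₀)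
    (topTwistTransfer_comb ρ hb n k₀) (frameValueBound_comb ρ hρ hρu hρi hb n k₀) hε hδ0 hδ

/-- **The onset floor for every compact `G`, uniform on a bounded mesh range** (the all-`G` analogue of the tree's
`typOnsetFloor`): for every mesh bound `B` there is `β₁` with NO mesh `1 ≤ b ≤ B` satisfying format T beyond `β₁` —
the typical onset `b⋆_T(β)` diverges for EVERY non-trivial compact gauge group and faithful `ρ`. -/
theorem typOnsetFloor_allG (hρ : Continuous ρ) (hρi : Function.Injective ρ)
    (hρu : ∀ g, ρ g ∈ Matrix.unitaryGroup (Fin N) ℂ) (hN : 1 ≤ N) (k₀ : G)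
    (n : ℕ) {ε δ : ℝ} (hε : 2 * ε < 1 - (ρ k₀).trace.re / N)
    (hδ0 : 0 ≤ δ) (hδ : 4 * ((windowCellsPlus n).card : ℝ) * δ < 1) (B : ℕ) :
    ∃ β₁ : ℝ, ∀ β : ℝ, β₁ ≤ β → ∀ b : ℕ, 1 ≤ b → b ≤ B → ¬ TypShellCond ρ β b n ε δ := by
  induction B with
  | zero => exact ⟨0, fun β _ b hb hb0 => absurd hb (by omega)⟩
  | succ B ih =>
    obtain ⟨β₁, h₁⟩ := ih
    obtain ⟨β₀, h₀⟩ :=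
      not_typShellCond_fixedMesh_allG ρ hρ hρi hρu hN k₀ (b := B + 1) (by omega) n hε hδ0 hδ
    refine ⟨max β₁ β₀, fun β hβ b hb hbB => ?_⟩
    rcases Nat.lt_or_ge b (B + 1) with hlt | hge
    · exact h₁ β ((le_max_left _ _).trans hβ) b hb (by omega)
    · obtain rfl : b = B + 1 := le_antisymm hbB hge
      exact h₀ β ((le_max_right _ _).trans hβ)

/-! ### rev 2 — the CLIPPED test: every budget `ε < 1`, every `k₀ ≠ 1`; ROW strength; certideate-2's Props -/

/-- **CORE FOR THE COMB WITH THE CLIPPED TEST (PROVED).**  For `k₀ ≠ 1` put `r = Re χ_ρ(k₀)/N < 1`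
(`re_trace_div_lt_one`) and shape the charged test by the clipped affine map
`ψ t = max (-1) (min 1 (2 (t − r)/(1 − r) − 1))`: `ψ 1 = 1`, `ψ r = −1`, `|ψ| ≤ 1`, `1 − ψ t ≤ (2/(1−r)) (1 − t)` for
`t ≤ 1`.  INPUT F for `(comb, ψ)` has value `ψ r = −1` (`frameValueBoundObs_comb`), so the core's budget `2ε < 1 − (−1)`
is EVERY `ε < 1`: at every fixed mesh, for all large `β`, NO measurable cell-local class satisfies clause (i) at the row
together with the single-cell torus anchor `δ` (`4·#windowCellsPlus(n)·δ < 1`). -/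
theorem frame_core_comb_clipped (hρ : Continuous ρ) (hρi : Function.Injective ρ)
    (hρu : ∀ g, ρ g ∈ Matrix.unitaryGroup (Fin N) ℂ) (hN : 1 ≤ N) {k₀ : G} (hk₀ : k₀ ≠ 1)
    {b : ℕ} (hb : 1 ≤ b) (n : ℕ) {ε δ : ℝ} (hε : ε < 1)
    (hδ0 : 0 ≤ δ) (hδ : 4 * ((windowCellsPlus n).card : ℝ) * δ < 1) :
    ∃ β₀ : ℝ, ∀ β : ℝ, β₀ ≤ β → ∀ Typ : (Fin 4 → ℤ) → Set (LGConfig 4 G),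
      (∀ c, MeasurableSet (Typ c)) →
      (∀ c, DependsOn (fun σ : LGConfig 4 G => σ ∈ Typ c) ↑(cellEdges (stdFrame b) c)) →
      RowClauseI ρ β (stdFrame b) n ε Typ →
      (∀ c ∈ windowCellsPlus n,
        (wilsonMeasure (d := 4) (L := 2 * ((2 * n + 2) * b + 1) + 1) ρ β)
          {V | torusLift (2 * ((2 * n + 2) * b + 1) + 1) V ∉ Typ c} ≤ ENNReal.ofReal δ) → False := by
  obtain ⟨r, hrdef⟩ : ∃ r : ℝ, (ρ k₀).trace.re / N = r := ⟨_, rfl⟩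
  have hr : r < 1 := hrdef ▸ re_trace_div_lt_one ρ hρi hρu hN hk₀
  have h1r : 0 < 1 - r := by linarith
  have h1r' : 1 - r ≠ 0 := h1r.ne'
  have hψc : Continuous fun t : ℝ => max (-1) (min 1 (2 * (t - r) / (1 - r) - 1)) :=
    continuous_const.max (continuous_const.min
      (((continuous_const.mul (continuous_id.sub continuous_const)).div_const _).sub continuous_const))
  have hψ1 : ∀ t : ℝ, |t| ≤ 1 → |max (-1) (min 1 (2 * (t - r) / (1 - r) - 1))| ≤ 1 := fun t _ =>
    abs_le.2 ⟨le_max_left _ _, max_le (by norm_num) (min_le_left _ _)⟩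
  have hψA : ∀ t : ℝ, t ≤ 1 → 1 - max (-1) (min 1 (2 * (t - r) / (1 - r) - 1)) ≤ 2 / (1 - r) * (1 - t) := by
    intro t ht
    have hφ : 1 - (2 * (t - r) / (1 - r) - 1) = 2 / (1 - r) * (1 - t) := by
      field_simp
      ring
    have hmin : min 1 (2 * (t - r) / (1 - r) - 1) ≤ max (-1) (min 1 (2 * (t - r) / (1 - r) - 1)) :=
      le_max_right _ _
    rcases le_total 1 (2 * (t - r) / (1 - r) - 1) with h | h
    · rw [min_eq_left h] at hmin ⊢
      have : 0 ≤ 2 / (1 - r) * (1 - t) := mul_nonneg (div_nonneg (by norm_num) h1r.le) (by linarith)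
      linarith
    · rw [min_eq_right h] at hmin ⊢
      linarith
  have hψr : max (-1 : ℝ) (min 1 (2 * (r - r) / (1 - r) - 1)) = -1 := by
    rw [sub_self, mul_zero, zero_div, zero_sub, min_eq_right (by norm_num), max_self]
  have hFψ : FrameValueBoundObs ρ (comb b ((2 * n + 2) * b + 1) k₀) b n
      (fun t : ℝ => max (-1) (min 1 (2 * (t - r) / (1 - r) - 1))) (-1) := by
    have h := frameValueBoundObs_comb ρ hρ hρu hρi hb n k₀ hψc
    rwa [hrdef, hψr] at h
  exact frame_core ρ hρ hρi hρu hN hb n (comb b ((2 * n + 2) * b + 1) k₀) hψc hψ1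
    (div_nonneg (by norm_num) h1r.le) hψA (topTwistTransfer_comb ρ hb n k₀) hFψ (by linarith) hδ0 hδ

/-- **HEADLINE′ (rev 2) — EVERY BUDGET `ε < 1`, EVERY `k₀ ≠ 1` (PROVED, sorry-free).**  For every compact (second
countable) `G`, every continuous faithful unitary `ρ` of degree `N ≥ 1`, every `k₀ ≠ 1`, mesh `b ≥ 1`, window `n`,
`ε < 1`, `0 ≤ δ`, `4·#windowCellsPlus(n)·δ < 1`:  `∃ β₀ ∀ β ≥ β₀, ¬ TypShellCond ρ β b n ε δ`. -/
theorem not_typShellCond_fixedMesh_allG' (hρ : Continuous ρ) (hρi : Function.Injective ρ)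
    (hρu : ∀ g, ρ g ∈ Matrix.unitaryGroup (Fin N) ℂ) (hN : 1 ≤ N) {k₀ : G} (hk₀ : k₀ ≠ 1)
    {b : ℕ} (hb : 1 ≤ b) (n : ℕ) {ε δ : ℝ} (hε : ε < 1)
    (hδ0 : 0 ≤ δ) (hδ : 4 * ((windowCellsPlus n).card : ℝ) * δ < 1) :
    ∃ β₀ : ℝ, ∀ β : ℝ, β₀ ≤ β → ¬ TypShellCond ρ β b n ε δ := by
  obtain ⟨β₀, hβ₀⟩ := frame_core_comb_clipped ρ hρ hρi hρu hN hk₀ hb n hε hδ0 hδ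
  refine ⟨β₀, fun β hβ hTyp => ?_⟩
  obtain ⟨Typ, hmeas, hdep, hI, hanch⟩ := clauseI_of_typShellCond hTyp
  exact hβ₀ β hβ Typ hmeas hdep (rowClauseI_of_clauseI hI) fun c' hc' =>
    hanch ((2 * n + 2) * b + 1) (by nlinarith) c' (stdFrame_windowCellsPlus_bounds hc')

/-- **The onset floor for every compact `G` at every budget `ε < 1` (rev 2).** -/
theorem typOnsetFloor_allG' (hρ : Continuous ρ) (hρi : Function.Injective ρ)
    (hρu : ∀ g, ρ g ∈ Matrix.unitaryGroup (Fin N) ℂ) (hN : 1 ≤ N) {k₀ : G} (hk₀ : k₀ ≠ 1)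
    (n : ℕ) {ε δ : ℝ} (hε : ε < 1)
    (hδ0 : 0 ≤ δ) (hδ : 4 * ((windowCellsPlus n).card : ℝ) * δ < 1) (B : ℕ) :
    ∃ β₁ : ℝ, ∀ β : ℝ, β₁ ≤ β → ∀ b : ℕ, 1 ≤ b → b ≤ B → ¬ TypShellCond ρ β b n ε δ := by
  induction B with
  | zero => exact ⟨0, fun β _ b hb hb0 => absurd hb (by omega)⟩
  | succ B ih =>
    obtain ⟨β₁, h₁⟩ := ih
    obtain ⟨β₀, h₀⟩ :=
      not_typShellCond_fixedMesh_allG' ρ hρ hρi hρu hN hk₀ (b := B + 1) (by omega) n hε hδ0 hδ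
    refine ⟨max β₁ β₀, fun β hβ b hb hbB => ?_⟩
    rcases Nat.lt_or_ge b (B + 1) with hlt | hge
    · exact h₁ β ((le_max_left _ _).trans hβ) b hb (by omega)
    · obtain rfl : b = B + 1 := le_antisymm hbB hge
      exact h₀ β ((le_max_right _ _).trans hβ)

/-- **ROW STRENGTH (rev 2; PROVED).**  The (weaker) ROW format `RowShellCond` — clause (i) asked ONLY at
`Y = rowCells n` — fails at every fixed mesh for all large `β`, for every compact `G`, faithful unitary `ρ`, `N ≥ 1`,
`k₀ ≠ 1`, `ε < 1`, `0 ≤ δ`, `4·#windowCellsPlus(n)·δ < 1` (only clause (i) at the row and the anchor (iii) at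
single cells are used; (ii) is not). -/
theorem not_rowShellCond_fixedMesh_allG (hρ : Continuous ρ) (hρi : Function.Injective ρ)
    (hρu : ∀ g, ρ g ∈ Matrix.unitaryGroup (Fin N) ℂ) (hN : 1 ≤ N) {k₀ : G} (hk₀ : k₀ ≠ 1)
    {b : ℕ} (hb : 1 ≤ b) (n : ℕ) {ε δ : ℝ} (hε : ε < 1)
    (hδ0 : 0 ≤ δ) (hδ : 4 * ((windowCellsPlus n).card : ℝ) * δ < 1) :
    ∃ β₀ : ℝ, ∀ β : ℝ, β₀ ≤ β → ¬ RowShellCond ρ β b n ε δ := by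
  obtain ⟨β₀, hβ₀⟩ := frame_core_comb_clipped ρ hρ hρi hρu hN hk₀ hb n hε hδ0 hδ
  refine ⟨β₀, fun β hβ hRow => ?_⟩
  obtain ⟨Typ, hmeas, hdep, hI, -, hIII⟩ := hRow (stdFrame b) (stdFrame_admissible b)
  refine hβ₀ β hβ Typ hmeas hdep hI fun c' hc' => ?_
  have h1 := hIII ((2 * n + 2) * b + 1) (by nlinarith) {c'} (Finset.singleton_nonempty c') (fun c hc => by
    rw [Finset.mem_singleton] at hc; subst hc; exact stdFrame_windowCellsPlus_bounds hc')
  simpa using h1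

/-- **ROW STRENGTH, U clothes (rev 2; PROVED).**  The same for `RowShellCondUKP`. -/
theorem not_rowShellCondUKP_fixedMesh_allG (hρ : Continuous ρ) (hρi : Function.Injective ρ)
    (hρu : ∀ g, ρ g ∈ Matrix.unitaryGroup (Fin N) ℂ) (hN : 1 ≤ N) {k₀ : G} (hk₀ : k₀ ≠ 1)
    {b : ℕ} (hb : 1 ≤ b) (n : ℕ) {ε δ : ℝ} (hε : ε < 1)
    (hδ0 : 0 ≤ δ) (hδ : 4 * ((windowCellsPlus n).card : ℝ) * δ < 1) :
    ∃ β₀ : ℝ, ∀ β : ℝ, β₀ ≤ β → ¬ RowShellCondUKP ρ β b n ε δ := by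
  obtain ⟨β₀, hβ₀⟩ := frame_core_comb_clipped ρ hρ hρi hρu hN hk₀ hb n hε hδ0 hδ
  refine ⟨β₀, fun β hβ hRow => ?_⟩
  obtain ⟨Typ, hmeas, hdep, hI, -, hIII⟩ := hRow (stdFrame b) (stdFrame_admissible b)
  refine hβ₀ β hβ Typ hmeas hdep hI fun c' hc' => ?_
  have h1 := hIII ((2 * n + 2) * b + 1) (by nlinarith) {c'} (Finset.singleton_nonempty c') (fun c hc => by
    rw [Finset.mem_singleton] at hc; subst hc; exact stdFrame_windowCellsPlus_bounds hc')
  simpa using h1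

/-- **certideate-2's `RowOnsetDivergesAny ρ` HOLDS — for every `ρ`, unconditionally (rev 2; PROVED).**  (Its hypotheses
`Nontrivial G`, continuity, faithfulness, unitarity, `1 ≤ N` are inside the Prop; pick any `k₀ ≠ 1`; its budget
`ε < 1/2` is inside ours `ε < 1`.)  Hence the guard `HasScalarCentre` of the row-onset split is NOT a divergence guard. -/
theorem rowOnsetDivergesAny_allG : RowOnsetDivergesAny ρ := by
  intro hnt hc hi hu hN b hb n ε δ _ hε2 hδ hδ'
  haveI := hnt
  obtain ⟨k₀, hk₀⟩ := exists_ne (1 : G)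
  exact not_rowShellCond_fixedMesh_allG ρ hc hi hu hN hk₀ hb n (by linarith) hδ hδ'

/-- **ctriage-2's S-ROS-6 `RowOnsetDivergesAll ρ` HOLDS (rev 2; PROVED).** -/
theorem rowOnsetDivergesAll_allG : RowOnsetDivergesAll ρ := rowOnsetDivergesAll_of_any (rowOnsetDivergesAny_allG ρ)

/-- **`RowOnsetDivergesAnyU ρ` HOLDS (rev 2; PROVED)** — the U-row format fails at every fixed mesh too. -/
theorem rowOnsetDivergesAnyU_allG : RowOnsetDivergesAnyU ρ := by
  intro hnt hc hi hu hN b hb n ε δ _ hε2 hδ hδ'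
  haveI := hnt
  obtain ⟨k₀, hk₀⟩ := exists_ne (1 : G)
  exact not_rowShellCondUKP_fixedMesh_allG ρ hc hi hu hN hk₀ hb n (by linarith) hδ hδ'

/-- **Nontrivial-`G` corollary (rev 2).**  On every NON-TRIVIAL compact `G`: format T fails at every fixed mesh for all
large `β` at every budget `ε < 1` (no element to choose). -/
theorem not_typShellCond_fixedMesh_of_nontrivial [Nontrivial G] (hρ : Continuous ρ) (hρi : Function.Injective ρ)
    (hρu : ∀ g, ρ g ∈ Matrix.unitaryGroup (Fin N) ℂ) (hN : 1 ≤ N)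
    {b : ℕ} (hb : 1 ≤ b) (n : ℕ) {ε δ : ℝ} (hε : ε < 1)
    (hδ0 : 0 ≤ δ) (hδ : 4 * ((windowCellsPlus n).card : ℝ) * δ < 1) :
    ∃ β₀ : ℝ, ∀ β : ℝ, β₀ ≤ β → ¬ TypShellCond ρ β b n ε δ := by
  obtain ⟨k₀, hk₀⟩ := exists_ne (1 : G)
  exact not_typShellCond_fixedMesh_allG' ρ hρ hρi hρu hN hk₀ hb n hε hδ0 hδ

end Headline

end Summit.QuantumFields.YangMills.Cruxes.IR.CruxIdea2g6

end
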